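import Literature.MathematicalPhysics.QuantumFieldTheory.QCDSiteRPAction
import Literature.MathematicalPhysics.QuantumFieldTheory.QCDSiteRPSliceVars
import Literature.MathematicalPhysics.QuantumFieldTheory.WilsonOddRPNegCoords
import Literature.MathematicalPhysics.QuantumFieldTheory.WilsonOddRPKernel
import Literature.MathematicalPhysics.QuantumFieldTheory.LatticeGaugeProofs
import Literature.MathematicalPhysics.QuantumLattice.GrassmannCoefficientRegularity
import Literature.MathematicalPhysics.QuantumLattice.GrassmannEffectiveAction
import Mathlib.Analysis.Matrix.PosDef
import HarnessLib

/-!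
# Site-reflection positivity of lattice QCD with Wilson quarks (`r = 1`) on the odd torus — the proof

Discharge of the named fact `WilsonQCDSiteReflectionPositivityAP` of `QCDTimeReflection`
(Lüscher 1977; Osterwalder–Seiler 1978 §2–§3; Montvay–Münster 1994 §4.2.3 (4.90)–(4.110), whose
printed proof is followed): for `β ≥ 0`, quark masses `m_f > −1`, `S ≥ 1` and a positive-time
gauge-invariant local observable `A` ending by time `S`, on the torus of odd side `L = 2S + 1` with
time-ANTIPERIODIC quarks, `⟨A · ΘA⟩_AP` is real and non-negative
(`WilsonQCDSiteReflectionPositivityAP_holds`, at the end of this file).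

The file is organised in five parts, each a closed namespace block with its own summary:

1. **Crossing** — the couplings of the rotated Wilson action `ψ̄M(U)ψ` (`QCDSiteRPAction`) across the
   antiperiodic layer `{S, S+1}` under the Osterwalder–Seiler link split `translateLayer S Y U`
   (`WilsonOddRPNegCoords`): `Q_c = Σ_w 2 ξ_w(Θ'U) Θ'ξ_w(splice(U,Y))` (`crossPart_translateLayer`).
2. **SliceAction** — the slice block `Q₀ = Q^{lu} + Q^{uu} + Q^{ll}`, `Θ'Q^{uu} = Q^{ll}`, and
   `Q^{lu} = φ(ψ̄(−K)ψ)` with the positive slice coupling `K = sliceK` of `QCDSiteRPSliceVars`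
   (Montvay–Münster (4.109)–(4.110)); supports of `Q₊`, `Q^{uu}`, `Q^{lu}`.
3. **Integrand** — `∫ A(V)(ΘA)(V)e^{−ψ̄D^{AP}(V)ψ} = det R ∫ 𝐀(V)Θ'(𝐀(Θ'V))e^{ψ̄M(V)ψ}` and, under the
   split, `𝐀Θ'𝐀 e^{ψ̄Mψ} = G Θ'H ∏_w(1 + 2ξ_wΘ'ξ_w) e^{Q^{lu}}` (Montvay–Münster (4.104)–(4.107)).
4. **Covariance** — the cone expansion, the reduction to the reflection slice and the Gaussian slice
   pairing (`GrassmannReflectionPositivity`, `GrassmannSiteReflectionPairing`,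
   `GrassmannGaussianPairing`): `∫ = c · det(−K) Σ_t 2^{|t|} Σ_{I,J} g_{tI}(Θ'U) conj g_{tJ}(z) Γ(K⁻¹)_{IJ}`.
5. **Final** — regularity of the coefficient functions (`GrassmannCoefficientRegularity`), the
   positive semidefinite slice kernel, the gauge-field positivity theorem
   `wilsonExpectation_nonneg_of_negCovariantKernel` (`WilsonOddRPKernel`), and the quotient `N/D`.

Everything is proved; no named fact is introduced. [cite: Luscher1977, §3] [cite: OsterwalderSeiler1978, §2–§3] [cite: MontvayMunster1994, §4.2.3 (4.90)–(4.110)]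
-/

/-!
## Part: The crossing couplings of the antiperiodic layer under the Osterwalder–Seiler link split

Companion of `QCDSiteRPAction` (the rotated antiperiodic Wilson quark action `ψ̄M(U)ψ` and its
crossing block `crossPart`) and of `WilsonOddRPNegCoords` (the layer `S → S+1` of temporal links of
the odd torus `L = 2S+1`, the split `translateLayer S Y U : U_c ↦ U_c Y_c`, the splice
`splice_{layer}(U, Y)`), for the site-reflection positivity proof of lattice QCD with Wilson quarks
(Montvay–Münster 1994 §4.2.3 (4.96), (4.103); Lüscher 1977 §3).

In the `γ₀`-diagonal frame the only couplings of the action across the layer are the temporal hops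
`S ↔ S+1`; they carry the antiperiodic sign (`apLinkSign = −1` exactly there) and, by
`rotDirac_apply_forward/backward`, involve only `ψ̄_{x,r≥2} ψ_{x',r≥2}` and `ψ̄_{x',r<2} ψ_{x,r<2}`
(`x` at time `S`, `x' = x + e₀`).  After the split `U_c = U_c Y_c` every such coupling FACTORISES
through the colour index `e` of the link into a product of a degree-one element built from
`negReflect U` and the reflection of the SAME element built from the splice:

* `xiVar w W` — for an upper generator slot `w` at time `S` (`layerGens S`): `η_{f,x,e,r}(W) =
  Σ_a (W_c⁻¹)_{ae} ψ̄_{f,x,a,r}` (`r ≥ 2`), `ζ_{f,x,e,r}(W) = Σ_b (W_c)_{eb} ψ_{f,x,b,r}` (`r < 2`);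
* **`crossPart_translateLayer`**:
  `Q_c(translateLayer S Y U) = Σ_{w ∈ layerGens S} 2 • ξ_w(negReflect U) · Θ'(ξ_w(splice_{layer}(U,Y)))`,
  the cone form required by `GrassmannAlgebra.mul_map_mul_ordProd_cone` (all coefficients `2 > 0`);
* `xiVar_eq_ι` (degree one), `xiVar_mem_spectator` (a spectator of `N ∪ Z`).

Everything is proved; no named fact.  References: Montvay–Münster (4.96), (4.103); K. Osterwalder,
E. Seiler, Ann. Phys. 110 (1978) 440, §3. [folklore]
-/

namespace Literature.MathematicalPhysics.QuantumFieldTheory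

open Literature.Probability Literature.Probability.LatticeModels
open Literature.MathematicalPhysics.QuantumLattice
open Literature.MathematicalPhysics.QuantumLattice.GrassmannAlgebra
open WilsonNegRP WilsonRP
open scoped ComplexConjugate Matrix

noncomputable section

local notation "𝔾" => Matrix.specialUnitaryGroup (Fin 3) ℂ

variable {Nf L : ℕ} [NeZero L]

/-! ## Odd-torus layer geometry -/

section Geometry

variable {S : ℕ} (hL : L = 2 * S + 1) (hS : 1 ≤ S)
include hL

omit [NeZero L] in
/-- `L / 2 = S`. [folklore] -/
theorem half_eq : L / 2 = S := by omega

/-- The time of `x + e₀` for `x` in the layer is `S + 1`. [folklore] -/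
theorem val_shift_zero_of_layer (hS : 1 ≤ S) {x : TorusSite 4 L} (hx : (x 0).val = S) :
    ((Site.shift x 0) 0).val = S + 1 := by
  have hx' : x 0 = (S : ZMod L) := by
    rw [← ZMod.natCast_zmod_val (x 0), hx]
  rw [shift_apply_self, hx', show ((S : ZMod L) + 1) = ((S + 1 : ℕ) : ZMod L) by push_cast; ring,
    ZMod.val_cast_of_lt (by omega)]

/-- For `x` in the layer, `θ(x + e₀) = x` (`θ t = −t`, `−(S+1) = S`). [folklore] -/
theorem negReflect_shift_of_layer {x : TorusSite 4 L} (hx : (x 0).val = S) :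
    Site.negReflect (Site.shift x 0) = x := by
  have h2 := two_S_add_one_eq_zero (L := L) hL
  have hx' : x 0 = (S : ZMod L) := by rw [← ZMod.natCast_zmod_val (x 0), hx]
  funext k
  by_cases hk : k = 0
  · subst hk
    rw [WilsonSiteRP.negReflect_apply_zero, shift_apply_self, hx']
    linear_combination -h2
  · rw [WilsonSiteRP.negReflect_apply_of_ne _ hk, shift_apply_of_ne _ hk]

/-- For `x` in the layer, `θ x = x + e₀`. [folklore] -/
theorem negReflect_of_layer {x : TorusSite 4 L} (hx : (x 0).val = S) :
    Site.negReflect x = Site.shift x 0 := by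
  rw [← negReflect_shift_of_layer hL hx, WilsonSiteRP.negReflect_negReflect, negReflect_shift_of_layer hL hx]

/-- The site-reflected field on a layer link: `(Θ'U)_c = U_c⁻¹`. [folklore] -/
theorem negReflect_cfg_layer (U : GaugeConfig 4 L 𝔾) {x : TorusSite 4 L} (hx : (x 0).val = S) :
    U.negReflect (x, 0) = (U (x, 0))⁻¹ := by
  rw [GaugeConfig.negReflect_apply_zero, negReflect_shift_of_layer hL hx]

omit [NeZero L] hL in
/-- The split field on a layer link: `U_c Y_c`. [folklore] -/
theorem translateLayer_layer (Y U : GaugeConfig 4 L 𝔾) {x : TorusSite 4 L} (hx : (x 0).val = S) :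
    translateLayer S Y U (x, 0) = U (x, 0) * Y (x, 0) := by
  simp [translateLayer, hx]

omit hL in
/-- The splice on a layer link: `Y_c`. [folklore] -/
theorem splice_layer (U Y : GaugeConfig 4 L 𝔾) {x : TorusSite 4 L} (hx : (x 0).val = S) :
    LatticeRP.splice (layerEdges S) (U, Y) (x, 0) = Y (x, 0) := by
  rw [LatticeRP.splice_apply, if_pos (by simp [layerEdges, hx])]

omit [NeZero L] in
/-- The antiperiodic sign sits on the layer. [folklore] -/
theorem apLinkSign_layer {x : TorusSite 4 L} (hx : (x 0).val = S) : apLinkSign L x 0 = -1 := by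
  rw [apLinkSign, if_pos ⟨rfl, by rw [hx, half_eq hL]⟩]

omit [NeZero L] hL in
/-- A spatial shift does not change the time. [folklore] -/
theorem shift_apply_zero_of_ne (x : TorusSite 4 L) {μ : Fin 4} (hμ : μ ≠ 0) : (Site.shift x μ) 0 = x 0 :=
  shift_apply_of_ne x (Ne.symm hμ)

omit [NeZero L] in
/-- Two different shifts of a site differ (`L > 1`). [folklore] -/
theorem shift_ne_shift (hS : 1 ≤ S) (x : TorusSite 4 L) {μ ν : Fin 4} (h : μ ≠ ν) : Site.shift x μ ≠ Site.shift x ν := by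
  intro he
  have := congrFun he μ
  rw [shift_apply_self, shift_apply_of_ne _ h] at this
  have h1 : (1 : ZMod L) = 0 := by simpa using this
  have : Fact (1 < L) := ⟨by omega⟩
  exact one_ne_zero h1

omit [NeZero L] in
/-- `x + e₀ + e_μ ≠ x` on a torus of side `≥ 3`. [folklore] -/
theorem shift_shift_ne (hS : 1 ≤ S) (x : TorusSite 4 L) (μ : Fin 4) : Site.shift (Site.shift x 0) μ ≠ x := by
  intro he
  have h0 := congrFun he 0
  by_cases hμ : μ = 0
  · subst hμ
    rw [shift_apply_self, shift_apply_self, add_assoc] at h0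
    have h2 : (2 : ZMod L) = 0 := by
      have := add_left_cancel (a := x 0) (h0.trans (add_zero _).symm)
      rw [one_add_one_eq_two] at this
      exact this
    have : ((2 : ℕ) : ZMod L) = 0 := by exact_mod_cast h2
    rw [ZMod.natCast_eq_zero_iff] at this
    have := Nat.le_of_dvd (by norm_num) this
    omega
  · rw [shift_apply_of_ne _ (Ne.symm hμ), shift_apply_self] at h0
    have h1 : (1 : ZMod L) = 0 := add_left_cancel (a := x 0) (h0.trans (add_zero _).symm)
    have : Fact (1 < L) := ⟨by omega⟩
    exact one_ne_zero h1

/-- The time of `x + e₀` in general. [folklore] -/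
theorem val_shift_zero (hS : 1 ≤ S) (x : TorusSite 4 L) : ((Site.shift x 0) 0).val = ((x 0).val + 1) % L := by
  haveI : Fact (1 < L) := ⟨by omega⟩
  rw [shift_apply_self, ZMod.val_add, ZMod.val_one]

omit [NeZero L] in
/-- Time arithmetic of a forward hop with crossing times: it crosses the layer. [folklore] -/
theorem crossR_forward_time (hS : 1 ≤ S) {tv tw : ℕ} (htw : tw = (tv + 1) % L) (hc : crossR L tv tw)
    (htv : tv < L) : tv = S := by
  unfold crossR at hc
  have hhalf : L / 2 = S := by omega
  rw [hhalf] at hc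
  by_cases hlt : tv + 1 < L
  · rw [Nat.mod_eq_of_lt hlt] at htw; omega
  · have heq : tv + 1 = L := by omega
    rw [heq, Nat.mod_self] at htw; omega

omit [NeZero L] in
/-- Time arithmetic of a backward hop with crossing times: it crosses the layer. [folklore] -/
theorem crossR_backward_time (hS : 1 ≤ S) {tv tw : ℕ} (htv : tv = (tw + 1) % L) (hc : crossR L tv tw)
    (htw : tw < L) : tw = S := by
  unfold crossR at hc
  have hhalf : L / 2 = S := by omega
  rw [hhalf] at hc
  by_cases hlt : tw + 1 < L
  · rw [Nat.mod_eq_of_lt hlt] at htv; omega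
  · have heq : tw + 1 = L := by omega
    rw [heq, Nat.mod_self] at htv; omega

end Geometry

/-! ## The layer variables `ξ` -/

section Xi

/-- **The layer variables** `ξ_w(W)`: for a `ψ̄`-slot `w = ψ̄_{f,x,e,r}`,
`η_{f,x,e,r}(W) = Σ_a (W(x,0)⁻¹)_{ae} ψ̄_{f,x,a,r}`; for a `ψ`-slot `w = ψ_{f,x,e,r}`,
`ζ_{f,x,e,r}(W) = Σ_b W(x,0)_{eb} ψ_{f,x,b,r}` (the colour-`e` components of `U_c⁻¹`-, `U_c`-transported
quark fields at the layer; Montvay–Münster (4.103) after the link split). [cite: MontvayMunster1994, §4.2.3 (4.96) and (4.103)] -/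
def xiVar (w : FermiIdx Nf L ⊕ₗ FermiIdx Nf L) (W : GaugeConfig 4 L 𝔾) : FermiAlg Nf L :=
  match ofLex w with
  | Sum.inl i =>
      ∑ a, ((((W ((quarkEquiv.symm i).2.1, 0))⁻¹ : 𝔾) : Matrix (Fin 3) (Fin 3) ℂ) a (quarkEquiv.symm i).2.2.1) •
        qbar ((quarkEquiv.symm i).1, ((quarkEquiv.symm i).2.1, a, (quarkEquiv.symm i).2.2.2))
  | Sum.inr i =>
      ∑ b, (((W ((quarkEquiv.symm i).2.1, 0) : 𝔾) : Matrix (Fin 3) (Fin 3) ℂ) (quarkEquiv.symm i).2.2.1 b) •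
        q ((quarkEquiv.symm i).1, ((quarkEquiv.symm i).2.1, b, (quarkEquiv.symm i).2.2.2))

/-- `ξ` on a `ψ̄`-slot. [folklore] -/
theorem xiVar_inl (v : QuarkVar Nf L) (W : GaugeConfig 4 L 𝔾) :
    xiVar (toLex (Sum.inl (quarkEquiv v))) W =
      ∑ a, ((((W (v.2.1, 0))⁻¹ : 𝔾) : Matrix (Fin 3) (Fin 3) ℂ) a v.2.2.1) • qbar (v.1, (v.2.1, a, v.2.2.2)) := by
  simp [xiVar]

/-- `ξ` on a `ψ`-slot. [folklore] -/
theorem xiVar_inr (v : QuarkVar Nf L) (W : GaugeConfig 4 L 𝔾) :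
    xiVar (toLex (Sum.inr (quarkEquiv v))) W =
      ∑ b, (((W (v.2.1, 0) : 𝔾) : Matrix (Fin 3) (Fin 3) ℂ) v.2.2.1 b) • q (v.1, (v.2.1, b, v.2.2.2)) := by
  simp [xiVar]

/-- `ξ_w(W)` is of degree one. [folklore] -/
theorem xiVar_eq_ι (w : FermiIdx Nf L ⊕ₗ FermiIdx Nf L) (W : GaugeConfig 4 L 𝔾) :
    ∃ v, xiVar w W = ExteriorAlgebra.ι ℂ v := by
  suffices h : xiVar w W ∈ LinearMap.range (ExteriorAlgebra.ι ℂ : ((FermiIdx Nf L ⊕ₗ FermiIdx Nf L) → ℂ) →ₗ[ℂ] FermiAlg Nf L) by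
    obtain ⟨v, hv⟩ := LinearMap.mem_range.1 h
    exact ⟨v, hv.symm⟩
  rcases h : ofLex w with i | i
  · have hw : w = toLex (Sum.inl (quarkEquiv (quarkEquiv.symm i))) := by rw [Equiv.apply_symm_apply, ← h, toLex_ofLex]
    rw [hw, xiVar_inl]
    exact Submodule.sum_mem _ fun a _ => Submodule.smul_mem _ _ (LinearMap.mem_range_self _ _)
  · have hw : w = toLex (Sum.inr (quarkEquiv (quarkEquiv.symm i))) := by rw [Equiv.apply_symm_apply, ← h, toLex_ofLex]
    rw [hw, xiVar_inr]
    exact Submodule.sum_mem _ fun b _ => Submodule.smul_mem _ _ (LinearMap.mem_range_self _ _)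

variable (S : ℕ) in
/-- **The layer generator slots**: upper generators at time `S` (`ψ̄_{x,r≥2}`, `ψ_{x,r<2}`, `x` in the
layer), indexing the crossing couplings. [folklore] -/
def layerGens : Finset (FermiIdx Nf L ⊕ₗ FermiIdx Nf L) :=
  Finset.univ.filter fun w => genTimeT w = S ∧ IsUpper w

/-- Membership in `layerGens`. [folklore] -/
@[simp] theorem mem_layerGens {S : ℕ} {w : FermiIdx Nf L ⊕ₗ FermiIdx Nf L} :
    w ∈ layerGens S ↔ genTimeT w = S ∧ IsUpper w := by
  simp [layerGens]

/-- `ξ_w(W)` for `w` in the layer involves only generators at time `S`, hence is a spectator of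
`N ∪ Z` when `1 ≤ S ≤ L/2`. [folklore] -/
theorem xiVar_mem_spectator {S : ℕ} (hS : 1 ≤ S) (hSL : S ≤ L / 2) {w : FermiIdx Nf L ⊕ₗ FermiIdx Nf L}
    (hw : w ∈ layerGens S) (W : GaugeConfig 4 L 𝔾) :
    xiVar w W ∈ spectatorSubalgebra ℂ (negGens Nf L ∪ zeroGens Nf L) := by
  rw [mem_layerGens] at hw
  rcases h : ofLex w with i | i
  · have hw' : w = toLex (Sum.inl (quarkEquiv (quarkEquiv.symm i))) := by rw [Equiv.apply_symm_apply, ← h, toLex_ofLex]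
    rw [hw'] at hw ⊢
    rw [xiVar_inl]
    refine Subalgebra.sum_mem _ fun a _ => Subalgebra.smul_mem _ ?_ _
    refine gen_mem_spectator_of_time ?_
    simp only [genTimeT, genIdx_inl, idxTime_quarkEquiv] at hw ⊢
    omega
  · have hw' : w = toLex (Sum.inr (quarkEquiv (quarkEquiv.symm i))) := by rw [Equiv.apply_symm_apply, ← h, toLex_ofLex]
    rw [hw'] at hw ⊢
    rw [xiVar_inr]
    refine Subalgebra.sum_mem _ fun b _ => Subalgebra.smul_mem _ ?_ _
    refine gen_mem_spectator_of_time ?_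
    simp only [genTimeT, genIdx_inr, idxTime_quarkEquiv] at hw ⊢
    omega

end Xi

/-! ## The crossing identity -/

section Crossing

variable {S : ℕ} (hL : L = 2 * S + 1) (hS : 1 ≤ S)

/-- Reindexing `quadratic` by quark variables. [folklore] -/
theorem quadratic_eq_sum_quarkVar (A : Matrix (FermiIdx Nf L) (FermiIdx Nf L) ℂ) :
    quadratic ℂ A = ∑ v : QuarkVar Nf L, ∑ w : QuarkVar Nf L, A (quarkEquiv v) (quarkEquiv w) • (qbar v * q w) := by
  rw [quadratic, ← Equiv.sum_comp quarkEquiv]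
  refine Finset.sum_congr rfl fun v _ => ?_
  rw [← Equiv.sum_comp quarkEquiv]
  rfl

/-- `quadratic` of a finite sum of matrices. [folklore] -/
theorem quadratic_finset_sum {K : Type*} (s : Finset K) (A : K → Matrix (FermiIdx Nf L) (FermiIdx Nf L) ℂ) :
    quadratic ℂ (∑ k ∈ s, A k) = ∑ k ∈ s, quadratic ℂ (A k) := by
  classical
  induction s using Finset.induction_on with
  | empty => simp
  | insert a s ha ih => rw [Finset.sum_insert ha, Finset.sum_insert ha, quadratic_add, ih]

/-- Collapsing a sum over quark variables constrained in flavour, site and spin to a colour sum. [folklore] -/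
theorem sum_quarkVar_ite {M : Type*} [AddCommMonoid M] (f : Fin Nf) (x : TorusSite 4 L) (r : Fin 4)
    (F : Fin 3 → M) :
    ∑ v : QuarkVar Nf L, (if v.1 = f ∧ v.2.1 = x ∧ v.2.2.2 = r then F v.2.2.1 else 0) = ∑ a, F a := by
  simp only [QuarkVar, Fintype.sum_prod_type]
  rw [Finset.sum_eq_single f (fun f' _ hf' => by simp [hf']) (fun h => absurd (Finset.mem_univ _) h)]
  rw [Finset.sum_eq_single x (fun x' _ hx' => by simp [hx']) (fun h => absurd (Finset.mem_univ _) h)]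
  refine Finset.sum_congr rfl fun a _ => ?_
  rw [Finset.sum_eq_single r (fun r' _ hr' => by simp [hr']) (fun h => absurd (Finset.mem_univ _) h)]
  simp

/-- A rank-one quadratic form: `(Σ_p c_p ψ̄_p)(Σ_q d_q ψ_q) = ψ̄ (c dᵀ) ψ`. [folklore] -/
theorem sum_smul_qbar_mul_sum_smul_q (c d : QuarkVar Nf L → ℂ) :
    (∑ v, c v • qbar v) * (∑ w, d w • q w) =
      quadratic ℂ (Matrix.of fun p q => c (quarkEquiv.symm p) * d (quarkEquiv.symm q)) := by
  rw [quadratic_eq_sum_quarkVar, Finset.sum_mul_sum]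
  refine Finset.sum_congr rfl fun v _ => Finset.sum_congr rfl fun w _ => ?_
  simp only [Matrix.of_apply, Equiv.symm_apply_apply]
  rw [smul_mul_smul_comm]

/-- A rank-one quadratic form, fields in the other order: `(Σ_q d_q ψ_q)(Σ_p c_p ψ̄_p) = −ψ̄ (c dᵀ) ψ`. [folklore] -/
theorem sum_smul_q_mul_sum_smul_qbar (c d : QuarkVar Nf L → ℂ) :
    (∑ w, d w • q w) * (∑ v, c v • qbar v) =
      quadratic ℂ (Matrix.of fun p q => -(c (quarkEquiv.symm p) * d (quarkEquiv.symm q))) := by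
  rw [quadratic_eq_sum_quarkVar, Finset.sum_mul_sum, Finset.sum_comm]
  refine Finset.sum_congr rfl fun v _ => Finset.sum_congr rfl fun w _ => ?_
  simp only [Matrix.of_apply, Equiv.symm_apply_apply]
  rw [smul_mul_smul_comm, q, qbar, psi_mul_psiBar, smul_neg, ← neg_smul, mul_comm (d w)]

variable (U Y : GaugeConfig 4 L 𝔾) (mq : Fin Nf → ℝ)

/-- The `η`-term matrix of a `ψ̄`-slot `u = (f,x,e,r)`: entries `ε_r U(x)_{ae} Y(x)_{eb}` at
`((f,x,a,r), (f,x+e₀,b,r))`. [folklore] -/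
def etaMat (u : QuarkVar Nf L) : Matrix (FermiIdx Nf L) (FermiIdx Nf L) ℂ := Matrix.of fun p q' =>
  if (quarkEquiv.symm p).1 = u.1 ∧ (quarkEquiv.symm p).2.1 = u.2.1 ∧ (quarkEquiv.symm p).2.2.2 = u.2.2.2 then
    (if (quarkEquiv.symm q').1 = u.1 ∧ (quarkEquiv.symm q').2.1 = Site.shift u.2.1 0 ∧
        (quarkEquiv.symm q').2.2.2 = u.2.2.2 then
      spinSign u.2.2.2 * ((U (u.2.1, 0) : 𝔾) : Matrix (Fin 3) (Fin 3) ℂ) (quarkEquiv.symm p).2.2.1 u.2.2.1 *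
        ((Y (u.2.1, 0) : 𝔾) : Matrix (Fin 3) (Fin 3) ℂ) u.2.2.1 (quarkEquiv.symm q').2.2.1
    else 0)
  else 0

/-- The `ζ`-term matrix of a `ψ`-slot `u = (f,x,e,r)`: entries `−ε_r (Y(x)⁻¹)_{ae} (U(x)⁻¹)_{eb}` at
`((f,x+e₀,a,r), (f,x,b,r))`. [folklore] -/
def zetaMat (u : QuarkVar Nf L) : Matrix (FermiIdx Nf L) (FermiIdx Nf L) ℂ := Matrix.of fun p q' =>
  if (quarkEquiv.symm p).1 = u.1 ∧ (quarkEquiv.symm p).2.1 = Site.shift u.2.1 0 ∧ (quarkEquiv.symm p).2.2.2 = u.2.2.2 then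
    (if (quarkEquiv.symm q').1 = u.1 ∧ (quarkEquiv.symm q').2.1 = u.2.1 ∧ (quarkEquiv.symm q').2.2.2 = u.2.2.2 then
      -(spinSign u.2.2.2 * (((Y (u.2.1, 0))⁻¹ : 𝔾) : Matrix (Fin 3) (Fin 3) ℂ) (quarkEquiv.symm p).2.2.1 u.2.2.1 *
        (((U (u.2.1, 0))⁻¹ : 𝔾) : Matrix (Fin 3) (Fin 3) ℂ) u.2.2.1 (quarkEquiv.symm q').2.2.1)
    else 0)
  else 0

include hL in
/-- **The `η`-term**: `η_u(Θ'U) · Θ'(η_u(z)) = ψ̄ (etaMat u) ψ` for `u` in the layer. [folklore] -/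
theorem xiVar_inl_mul_map (u : QuarkVar Nf L) (hu : (u.2.1 0).val = S) :
    xiVar (toLex (Sum.inl (quarkEquiv u))) U.negReflect *
        fermiThetaRot (xiVar (toLex (Sum.inl (quarkEquiv u))) (LatticeRP.splice (layerEdges S) (U, Y))) =
      quadratic ℂ (etaMat U Y u) := by
  obtain ⟨f, x, e, r⟩ := u
  simp only at hu ⊢
  rw [xiVar_inl, xiVar_inl, negReflect_cfg_layer hL U hu, inv_inv, splice_layer U Y hu,
    (fermiThetaRot (Nf := Nf) (L := L)).map_sum]
  simp only [(fermiThetaRot (Nf := Nf) (L := L)).map_smul, fermiThetaRot_qbar, negReflect_of_layer hL hu, smul_smul]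
  -- both sides as rank-one forms over all quark variables
  have hl : ∑ a, ((U (x, 0) : 𝔾) : Matrix (Fin 3) (Fin 3) ℂ) a e • qbar (f, (x, a, r)) =
      ∑ v : QuarkVar Nf L, (if v.1 = f ∧ v.2.1 = x ∧ v.2.2.2 = r then
        ((U (x, 0) : 𝔾) : Matrix (Fin 3) (Fin 3) ℂ) v.2.2.1 e else 0) • qbar v := by
    rw [← sum_quarkVar_ite f x r (fun a => ((U (x, 0) : 𝔾) : Matrix (Fin 3) (Fin 3) ℂ) a e • qbar (f, (x, a, r)))]
    refine Finset.sum_congr rfl fun v _ => ?_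
    split_ifs with h
    · obtain ⟨f', x', a', r'⟩ := v
      simp only at h
      obtain ⟨rfl, rfl, rfl⟩ := h
      rfl
    · rw [zero_smul]
  have hr : ∑ a, (conj ((((Y (x, 0))⁻¹ : 𝔾) : Matrix (Fin 3) (Fin 3) ℂ) a e) * spinSign r) •
        q (f, (Site.shift x 0, a, r)) =
      ∑ w : QuarkVar Nf L, (if w.1 = f ∧ w.2.1 = Site.shift x 0 ∧ w.2.2.2 = r then
        spinSign r * ((Y (x, 0) : 𝔾) : Matrix (Fin 3) (Fin 3) ℂ) e w.2.2.1 else 0) • q w := by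
    conv_lhs => arg 2; ext a; rw [← Complex.star_def, star_specialUnitary_inv_apply, mul_comm]
    rw [← sum_quarkVar_ite f (Site.shift x 0) r (fun a =>
      (spinSign r * ((Y (x, 0) : 𝔾) : Matrix (Fin 3) (Fin 3) ℂ) e a) • q (f, (Site.shift x 0, a, r)))]
    refine Finset.sum_congr rfl fun w _ => ?_
    split_ifs with h
    · obtain ⟨f', x', a', r'⟩ := w
      simp only at h
      obtain ⟨rfl, rfl, rfl⟩ := h
      rfl
    · rw [zero_smul]
  rw [hl, hr, sum_smul_qbar_mul_sum_smul_q]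
  congr 1
  ext p q'
  simp only [Matrix.of_apply, etaMat]
  split_ifs <;> ring

include hL in
/-- **The `ζ`-term**: `ζ_u(Θ'U) · Θ'(ζ_u(z)) = ψ̄ (zetaMat u) ψ` for `u` in the layer. [folklore] -/
theorem xiVar_inr_mul_map (u : QuarkVar Nf L) (hu : (u.2.1 0).val = S) :
    xiVar (toLex (Sum.inr (quarkEquiv u))) U.negReflect *
        fermiThetaRot (xiVar (toLex (Sum.inr (quarkEquiv u))) (LatticeRP.splice (layerEdges S) (U, Y))) =
      quadratic ℂ (zetaMat U Y u) := by
  obtain ⟨f, x, e, r⟩ := u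
  simp only at hu ⊢
  rw [xiVar_inr, xiVar_inr, negReflect_cfg_layer hL U hu, splice_layer U Y hu,
    (fermiThetaRot (Nf := Nf) (L := L)).map_sum]
  simp only [(fermiThetaRot (Nf := Nf) (L := L)).map_smul, fermiThetaRot_q, negReflect_of_layer hL hu, smul_smul]
  have hl : ∑ b, ((((U (x, 0))⁻¹ : 𝔾) : Matrix (Fin 3) (Fin 3) ℂ) e b) • q (f, (x, b, r)) =
      ∑ w : QuarkVar Nf L, (if w.1 = f ∧ w.2.1 = x ∧ w.2.2.2 = r then
        (((U (x, 0))⁻¹ : 𝔾) : Matrix (Fin 3) (Fin 3) ℂ) e w.2.2.1 else 0) • q w := by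
    rw [← sum_quarkVar_ite f x r (fun b => ((((U (x, 0))⁻¹ : 𝔾) : Matrix (Fin 3) (Fin 3) ℂ) e b) • q (f, (x, b, r)))]
    refine Finset.sum_congr rfl fun w _ => ?_
    split_ifs with h
    · obtain ⟨f', x', a', r'⟩ := w
      simp only at h
      obtain ⟨rfl, rfl, rfl⟩ := h
      rfl
    · rw [zero_smul]
  have hr : ∑ b, (conj (((Y (x, 0) : 𝔾) : Matrix (Fin 3) (Fin 3) ℂ) e b) * spinSign r) •
        qbar (f, (Site.shift x 0, b, r)) =
      ∑ v : QuarkVar Nf L, (if v.1 = f ∧ v.2.1 = Site.shift x 0 ∧ v.2.2.2 = r then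
        spinSign r * (((Y (x, 0))⁻¹ : 𝔾) : Matrix (Fin 3) (Fin 3) ℂ) v.2.2.1 e else 0) • qbar v := by
    conv_lhs => arg 2; ext b; rw [← Complex.star_def, star_specialUnitary_apply, mul_comm]
    rw [← sum_quarkVar_ite f (Site.shift x 0) r (fun a =>
      (spinSign r * (((Y (x, 0))⁻¹ : 𝔾) : Matrix (Fin 3) (Fin 3) ℂ) a e) • qbar (f, (Site.shift x 0, a, r)))]
    refine Finset.sum_congr rfl fun v _ => ?_
    split_ifs with h
    · obtain ⟨f', x', a', r'⟩ := v
      simp only at h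
      obtain ⟨rfl, rfl, rfl⟩ := h
      rfl
    · rw [zero_smul]
  rw [hl, hr, sum_smul_q_mul_sum_smul_qbar]
  congr 1
  ext p q'
  simp only [Matrix.of_apply, zetaMat]
  split_ifs <;> ring

/-- The per-slot crossing matrix. [folklore] -/
def crossGenMat (w : FermiIdx Nf L ⊕ₗ FermiIdx Nf L) : Matrix (FermiIdx Nf L) (FermiIdx Nf L) ℂ :=
  match ofLex w with
  | Sum.inl i => etaMat U Y (quarkEquiv.symm i)
  | Sum.inr i => zetaMat U Y (quarkEquiv.symm i)

include hL in
/-- The per-slot crossing term is the quadratic form of the per-slot matrix. [folklore] -/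
theorem xiVar_mul_map_of_mem {w : FermiIdx Nf L ⊕ₗ FermiIdx Nf L} (hw : w ∈ layerGens S) :
    xiVar w U.negReflect * fermiThetaRot (xiVar w (LatticeRP.splice (layerEdges S) (U, Y))) =
      quadratic ℂ (crossGenMat U Y w) := by
  rw [mem_layerGens] at hw
  rcases h : ofLex w with i | i
  · have hw' : w = toLex (Sum.inl (quarkEquiv (quarkEquiv.symm i))) := by rw [Equiv.apply_symm_apply, ← h, toLex_ofLex]
    have hu : ((quarkEquiv.symm i).2.1 0).val = S := by
      rw [hw'] at hw; simpa [genTimeT, idxTime] using hw.1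
    rw [hw', xiVar_inl_mul_map hL U Y _ hu]
    simp [crossGenMat]
  · have hw' : w = toLex (Sum.inr (quarkEquiv (quarkEquiv.symm i))) := by rw [Equiv.apply_symm_apply, ← h, toLex_ofLex]
    have hu : ((quarkEquiv.symm i).2.1 0).val = S := by
      rw [hw'] at hw; simpa [genTimeT, idxTime] using hw.1
    rw [hw', xiVar_inr_mul_map hL U Y _ hu]
    simp [crossGenMat]

/-- A sum over the layer slots, split into `ψ̄`- and `ψ`-slots and reindexed by quark variables. [folklore] -/
theorem sum_layerGens_eq {M : Type*} [AddCommMonoid M] (g : FermiIdx Nf L ⊕ₗ FermiIdx Nf L → M) :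
    ∑ w ∈ layerGens S, g w =
      (∑ u : QuarkVar Nf L, if (u.2.1 0).val = S ∧ 2 ≤ (u.2.2.2).val then g (toLex (Sum.inl (quarkEquiv u))) else 0) +
      ∑ u : QuarkVar Nf L, if (u.2.1 0).val = S ∧ (u.2.2.2).val < 2 then g (toLex (Sum.inr (quarkEquiv u))) else 0 := by
  rw [layerGens, Finset.sum_filter, ← Equiv.sum_comp (toLex : FermiIdx Nf L ⊕ FermiIdx Nf L ≃ _), Fintype.sum_sum_type,
    ← Equiv.sum_comp quarkEquiv, ← Equiv.sum_comp quarkEquiv]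
  congr 1
  · refine Finset.sum_congr rfl fun u _ => ?_
    simp [genTimeT]
  · refine Finset.sum_congr rfl fun u _ => ?_
    simp [genTimeT]

include hL hS in
/-- **The crossing block of the split field, entrywise**: at `((f,x,a,r),(f,x+e₀,b,r))` with `x` in the
layer it is `−(1−ε_r)(U_cY_c)_{ab}`, at `((f,x+e₀,a,r),(f,x,b,r))` it is `−(1+ε_r)((U_cY_c)⁻¹)_{ab}`,
and it vanishes elsewhere. [cite: MontvayMunster1994, §4.2.3 (4.103)] -/
theorem maskT_crossR_rotDirac_translateLayer (v w : QuarkVar Nf L) :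
    maskT (crossR L) (rotDirac (translateLayer S Y U) mq) (quarkEquiv v) (quarkEquiv w) =
      if v.1 = w.1 ∧ v.2.2.2 = w.2.2.2 then
        (if (v.2.1 0).val = S ∧ w.2.1 = Site.shift v.2.1 0 then
          -(1 - spinSign v.2.2.2) * ((U (v.2.1, 0) * Y (v.2.1, 0) : 𝔾) : Matrix (Fin 3) (Fin 3) ℂ) v.2.2.1 w.2.2.1
        else if (w.2.1 0).val = S ∧ v.2.1 = Site.shift w.2.1 0 then
          -(1 + spinSign v.2.2.2) *
            ((((U (w.2.1, 0) * Y (w.2.1, 0))⁻¹ : 𝔾)) : Matrix (Fin 3) (Fin 3) ℂ) v.2.2.1 w.2.2.1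
        else 0)
      else 0 := by
  have hhalf : L / 2 = S := half_eq hL
  set V := translateLayer S Y U with hV
  rw [maskT_apply, idxTime_quarkEquiv, idxTime_quarkEquiv]
  have htv := ZMod.val_lt (v.2.1 0)
  have htw := ZMod.val_lt (w.2.1 0)
  by_cases hA : (v.2.1 0).val = S ∧ w.2.1 = Site.shift v.2.1 0
  · -- forward hop across the layer
    have hx := hA.1
    have hw := hA.2
    have htw' : (w.2.1 0).val = S + 1 := by rw [hw]; exact val_shift_zero_of_layer hL hS hx
    have hcross : crossR L (v.2.1 0).val (w.2.1 0).val := Or.inl ⟨by omega, by omega, by omega⟩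
    rw [if_pos hcross]
    have hxy : ¬ (v.2.1 = w.2.1 ∧ v.2.2.1 = w.2.2.1) := fun h => by
      have := congrArg (fun y : TorusSite 4 L => (y 0).val) h.1; omega
    rw [rotDirac_apply_forward V mq v w hxy]
    · by_cases hfr : v.1 = w.1 ∧ v.2.2.2 = w.2.2.2
      · rw [if_pos hfr, if_pos hfr, if_pos hA, hopF, if_pos hw, apLinkSign_layer hL hx, hV,
          translateLayer_layer Y U hx]
        ring
      · rw [if_neg hfr, if_neg hfr]
    · intro μ hμ
      rw [hopF, if_neg]
      rw [hw]
      exact shift_ne_shift hL hS v.2.1 (Ne.symm hμ)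
    · intro μ
      rw [hopB, if_neg]
      rw [hw]
      exact (shift_shift_ne hL hS v.2.1 μ).symm
  · by_cases hB : (w.2.1 0).val = S ∧ v.2.1 = Site.shift w.2.1 0
    · -- backward hop across the layer
      have hx := hB.1
      have hvx := hB.2
      have htv' : (v.2.1 0).val = S + 1 := by rw [hvx]; exact val_shift_zero_of_layer hL hS hx
      have hcross : crossR L (v.2.1 0).val (w.2.1 0).val := Or.inr ⟨by omega, by omega, by omega⟩
      rw [if_pos hcross]
      have hxy : ¬ (v.2.1 = w.2.1 ∧ v.2.2.1 = w.2.2.1) := fun h => by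
        have := congrArg (fun y : TorusSite 4 L => (y 0).val) h.1; omega
      rw [rotDirac_apply_backward V mq v w hxy]
      · by_cases hfr : v.1 = w.1 ∧ v.2.2.2 = w.2.2.2
        · rw [if_pos hfr, if_pos hfr, if_neg hA, if_pos hB, hopB, if_pos hvx, apLinkSign_layer hL hx, hV,
            translateLayer_layer Y U hx]
          ring
        · rw [if_neg hfr, if_neg hfr]
      · intro μ
        rw [hopF, if_neg]
        rw [hvx]
        exact (shift_shift_ne hL hS w.2.1 μ).symm
      · intro μ hμ
        rw [hopB, if_neg]
        rw [hvx]
        exact shift_ne_shift hL hS w.2.1 (Ne.symm hμ)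
    · -- no coupling
      have hrhs : (if v.1 = w.1 ∧ v.2.2.2 = w.2.2.2 then
          (if (v.2.1 0).val = S ∧ w.2.1 = Site.shift v.2.1 0 then
            -(1 - spinSign v.2.2.2) * ((U (v.2.1, 0) * Y (v.2.1, 0) : 𝔾) : Matrix (Fin 3) (Fin 3) ℂ) v.2.2.1 w.2.2.1
          else if (w.2.1 0).val = S ∧ v.2.1 = Site.shift w.2.1 0 then
            -(1 + spinSign v.2.2.2) *
              ((((U (w.2.1, 0) * Y (w.2.1, 0))⁻¹ : 𝔾)) : Matrix (Fin 3) (Fin 3) ℂ) v.2.2.1 w.2.2.1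
          else 0) else 0) = 0 := by
        rw [if_neg hA, if_neg hB]; split_ifs <;> rfl
      rw [hrhs]
      by_cases hcross : crossR L (v.2.1 0).val (w.2.1 0).val
      · rw [if_pos hcross]
        have hne : (v.2.1 0).val ≠ (w.2.1 0).val := by
          rcases hcross with ⟨_, h2, h3⟩ | ⟨h1, _, h3⟩ <;> omega
        have hxy : ¬ (v.2.1 = w.2.1 ∧ v.2.2.1 = w.2.2.1) := fun h => hne (by rw [h.1])
        refine rotDirac_apply_eq_zero V mq v w hxy (fun μ => ?_) (fun μ => ?_)
        · rw [hopF, if_neg]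
          intro hw
          by_cases hμ : μ = 0
          · subst hμ
            have ht : (w.2.1 0).val = ((v.2.1 0).val + 1) % L := by rw [hw, val_shift_zero hL hS]
            exact hA ⟨crossR_forward_time hL hS ht hcross htv, hw⟩
          · have h1 : w.2.1 0 = v.2.1 0 := by rw [hw, shift_apply_zero_of_ne _ hμ]
            exact hne (by rw [h1])
        · rw [hopB, if_neg]
          intro hv
          by_cases hμ : μ = 0
          · subst hμ
            have ht : (v.2.1 0).val = ((w.2.1 0).val + 1) % L := by rw [hv, val_shift_zero hL hS]
            exact hB ⟨crossR_backward_time hL hS ht hcross htw, hv⟩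
          · have h1 : v.2.1 0 = w.2.1 0 := by rw [hv, shift_apply_zero_of_ne _ hμ]
            exact hne (by rw [h1])
      · rw [if_neg hcross]

/-- Entries of a product of two group elements. [folklore] -/
theorem specialUnitary_mul_apply (A B : 𝔾) (a b : Fin 3) :
    ((A * B : 𝔾) : Matrix (Fin 3) (Fin 3) ℂ) a b =
      ∑ e, (A : Matrix (Fin 3) (Fin 3) ℂ) a e * (B : Matrix (Fin 3) (Fin 3) ℂ) e b := by
  rw [Submonoid.coe_mul, Matrix.mul_apply]

/-- The collapsed `η`-sum at an entry. [folklore] -/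
theorem sum_ite_etaMat (v w' : QuarkVar Nf L) :
    (∑ u : QuarkVar Nf L, if (u.2.1 0).val = S ∧ 2 ≤ (u.2.2.2).val then
        (2 : ℂ) * etaMat U Y u (quarkEquiv v) (quarkEquiv w') else 0) =
      if (v.2.1 0).val = S ∧ 2 ≤ (v.2.2.2).val ∧ w'.1 = v.1 ∧ w'.2.1 = Site.shift v.2.1 0 ∧ w'.2.2.2 = v.2.2.2 then
        2 * (spinSign v.2.2.2 * ((U (v.2.1, 0) * Y (v.2.1, 0) : 𝔾) : Matrix (Fin 3) (Fin 3) ℂ) v.2.2.1 w'.2.2.1)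
      else 0 := by
  have key : ∀ u : QuarkVar Nf L, (if (u.2.1 0).val = S ∧ 2 ≤ (u.2.2.2).val then
        (2 : ℂ) * etaMat U Y u (quarkEquiv v) (quarkEquiv w') else 0) =
      if u.1 = v.1 ∧ u.2.1 = v.2.1 ∧ u.2.2.2 = v.2.2.2 then
        (if (v.2.1 0).val = S ∧ 2 ≤ (v.2.2.2).val ∧ w'.1 = v.1 ∧ w'.2.1 = Site.shift v.2.1 0 ∧ w'.2.2.2 = v.2.2.2 then
          2 * (spinSign v.2.2.2 * (((U (v.2.1, 0) : 𝔾) : Matrix (Fin 3) (Fin 3) ℂ) v.2.2.1 u.2.2.1 *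
            ((Y (v.2.1, 0) : 𝔾) : Matrix (Fin 3) (Fin 3) ℂ) u.2.2.1 w'.2.2.1)) else 0) else 0 := by
    intro u
    obtain ⟨f, x, e, r⟩ := u
    simp only [etaMat, Matrix.of_apply, Equiv.symm_apply_apply]
    by_cases h : f = v.1 ∧ x = v.2.1 ∧ r = v.2.2.2
    · obtain ⟨rfl, rfl, rfl⟩ := h
      simp only [if_true, and_true]
      by_cases h1 : (v.2.1 0).val = S ∧ 2 ≤ (v.2.2.2).val
      · obtain ⟨h1a, h1b⟩ := h1
        simp only [h1a, h1b, if_true, true_and]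
        split_ifs <;> ring
      · rw [if_neg h1]
        split_ifs with h2
        · exact (h1 ⟨h2.1, h2.2.1⟩).elim
        · rfl
    · rw [if_neg h]
      have h' : ¬ (v.1 = f ∧ v.2.1 = x ∧ v.2.2.2 = r) := fun e => h ⟨e.1.symm, e.2.1.symm, e.2.2.symm⟩
      simp only [h', if_false, mul_zero, ite_self]
  simp only [key]
  rw [sum_quarkVar_ite v.1 v.2.1 v.2.2.2 (fun e => if (v.2.1 0).val = S ∧ 2 ≤ (v.2.2.2).val ∧ w'.1 = v.1 ∧
      w'.2.1 = Site.shift v.2.1 0 ∧ w'.2.2.2 = v.2.2.2 then 2 * (spinSign v.2.2.2 *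
      (((U (v.2.1, 0) : 𝔾) : Matrix (Fin 3) (Fin 3) ℂ) v.2.2.1 e * ((Y (v.2.1, 0) : 𝔾) : Matrix (Fin 3) (Fin 3) ℂ) e w'.2.2.1))
      else 0)]
  by_cases hc : (v.2.1 0).val = S ∧ 2 ≤ (v.2.2.2).val ∧ w'.1 = v.1 ∧ w'.2.1 = Site.shift v.2.1 0 ∧ w'.2.2.2 = v.2.2.2
  · simp only [hc, and_self, if_true]
    rw [specialUnitary_mul_apply, Finset.mul_sum, Finset.mul_sum]
  · simp only [hc, if_false, Finset.sum_const_zero]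

/-- The collapsed `ζ`-sum at an entry. [folklore] -/
theorem sum_ite_zetaMat (v w' : QuarkVar Nf L) :
    (∑ u : QuarkVar Nf L, if (u.2.1 0).val = S ∧ (u.2.2.2).val < 2 then
        (2 : ℂ) * zetaMat U Y u (quarkEquiv v) (quarkEquiv w') else 0) =
      if (w'.2.1 0).val = S ∧ (w'.2.2.2).val < 2 ∧ v.1 = w'.1 ∧ v.2.1 = Site.shift w'.2.1 0 ∧ v.2.2.2 = w'.2.2.2 then
        2 * -(spinSign w'.2.2.2 *
          ((((U (w'.2.1, 0) * Y (w'.2.1, 0))⁻¹ : 𝔾)) : Matrix (Fin 3) (Fin 3) ℂ) v.2.2.1 w'.2.2.1)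
      else 0 := by
  have key : ∀ u : QuarkVar Nf L, (if (u.2.1 0).val = S ∧ (u.2.2.2).val < 2 then
        (2 : ℂ) * zetaMat U Y u (quarkEquiv v) (quarkEquiv w') else 0) =
      if u.1 = w'.1 ∧ u.2.1 = w'.2.1 ∧ u.2.2.2 = w'.2.2.2 then
        (if (w'.2.1 0).val = S ∧ (w'.2.2.2).val < 2 ∧ v.1 = w'.1 ∧ v.2.1 = Site.shift w'.2.1 0 ∧ v.2.2.2 = w'.2.2.2 then
          2 * -(spinSign w'.2.2.2 * (((((Y (w'.2.1, 0))⁻¹ : 𝔾)) : Matrix (Fin 3) (Fin 3) ℂ) v.2.2.1 u.2.2.1 *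
            (((U (w'.2.1, 0))⁻¹ : 𝔾) : Matrix (Fin 3) (Fin 3) ℂ) u.2.2.1 w'.2.2.1)) else 0) else 0 := by
    intro u
    obtain ⟨f, x, e, r⟩ := u
    simp only [zetaMat, Matrix.of_apply, Equiv.symm_apply_apply]
    by_cases h : f = w'.1 ∧ x = w'.2.1 ∧ r = w'.2.2.2
    · obtain ⟨rfl, rfl, rfl⟩ := h
      simp only [if_true, and_true]
      by_cases h1 : (w'.2.1 0).val = S ∧ (w'.2.2.2).val < 2
      · obtain ⟨h1a, h1b⟩ := h1
        simp only [h1a, h1b, true_and, if_true]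
        split_ifs <;> ring
      · rw [if_neg h1]
        split_ifs with h2
        · exact (h1 ⟨h2.1, h2.2.1⟩).elim
        · simp
    · rw [if_neg h]
      have h' : ¬ (w'.1 = f ∧ w'.2.1 = x ∧ w'.2.2.2 = r) := fun e => h ⟨e.1.symm, e.2.1.symm, e.2.2.symm⟩
      simp only [h', if_false, ite_self, mul_zero]
  simp only [key]
  rw [sum_quarkVar_ite w'.1 w'.2.1 w'.2.2.2 (fun e => if (w'.2.1 0).val = S ∧ (w'.2.2.2).val < 2 ∧ v.1 = w'.1 ∧
      v.2.1 = Site.shift w'.2.1 0 ∧ v.2.2.2 = w'.2.2.2 then 2 * -(spinSign w'.2.2.2 *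
      (((((Y (w'.2.1, 0))⁻¹ : 𝔾)) : Matrix (Fin 3) (Fin 3) ℂ) v.2.2.1 e * (((U (w'.2.1, 0))⁻¹ : 𝔾) : Matrix (Fin 3) (Fin 3) ℂ) e w'.2.2.1))
      else 0)]
  by_cases hc : (w'.2.1 0).val = S ∧ (w'.2.2.2).val < 2 ∧ v.1 = w'.1 ∧ v.2.1 = Site.shift w'.2.1 0 ∧ v.2.2.2 = w'.2.2.2
  · simp only [hc, and_self, if_true]
    rw [mul_inv_rev, specialUnitary_mul_apply, Finset.mul_sum, ← Finset.sum_neg_distrib, Finset.mul_sum]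
  · simp only [hc, if_false, Finset.sum_const_zero]

include hL hS in
/-- **The crossing block of the split field is the sum of the per-slot matrices.** [cite: MontvayMunster1994, §4.2.3 (4.103)] -/
theorem maskT_crossR_rotDirac_eq_sum :
    maskT (crossR L) (rotDirac (translateLayer S Y U) mq) = ∑ w ∈ layerGens S, (2 : ℂ) • crossGenMat U Y w := by
  ext p q'
  obtain ⟨v, rfl⟩ := quarkEquiv.surjective p
  obtain ⟨w', rfl⟩ := quarkEquiv.surjective q'
  rw [maskT_crossR_rotDirac_translateLayer hL hS U Y mq v w', Matrix.sum_apply, sum_layerGens_eq]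
  have h1 : ∀ u : QuarkVar Nf L, ((2 : ℂ) • crossGenMat U Y (toLex (Sum.inl (quarkEquiv u)))) (quarkEquiv v) (quarkEquiv w') =
      2 * etaMat U Y u (quarkEquiv v) (quarkEquiv w') := fun u => by simp [crossGenMat]
  have h2 : ∀ u : QuarkVar Nf L, ((2 : ℂ) • crossGenMat U Y (toLex (Sum.inr (quarkEquiv u)))) (quarkEquiv v) (quarkEquiv w') =
      2 * zetaMat U Y u (quarkEquiv v) (quarkEquiv w') := fun u => by simp [crossGenMat]
  simp only [h1, h2]
  rw [sum_ite_etaMat, sum_ite_zetaMat]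
  have htv := ZMod.val_lt (v.2.1 0)
  have htw := ZMod.val_lt (w'.2.1 0)
  by_cases hA : (v.2.1 0).val = S ∧ w'.2.1 = Site.shift v.2.1 0
  · have htw' : (w'.2.1 0).val = S + 1 := by rw [hA.2]; exact val_shift_zero_of_layer hL hS hA.1
    have hB2 : ¬ ((w'.2.1 0).val = S ∧ (w'.2.2.2).val < 2 ∧ v.1 = w'.1 ∧ v.2.1 = Site.shift w'.2.1 0 ∧
        v.2.2.2 = w'.2.2.2) := fun h => by have := h.1; omega
    rw [if_neg hB2, add_zero]
    by_cases hfr : v.1 = w'.1 ∧ v.2.2.2 = w'.2.2.2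
    · rw [if_pos hfr, if_pos hA]
      by_cases hr : 2 ≤ (v.2.2.2).val
      · have hc : (v.2.1 0).val = S ∧ 2 ≤ (v.2.2.2).val ∧ w'.1 = v.1 ∧ w'.2.1 = Site.shift v.2.1 0 ∧
            w'.2.2.2 = v.2.2.2 := ⟨hA.1, hr, hfr.1.symm, hA.2, hfr.2.symm⟩
        rw [if_pos hc, spinSign_of_le hr]; ring
      · have hc : ¬ ((v.2.1 0).val = S ∧ 2 ≤ (v.2.2.2).val ∧ w'.1 = v.1 ∧ w'.2.1 = Site.shift v.2.1 0 ∧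
            w'.2.2.2 = v.2.2.2) := fun h => hr h.2.1
        rw [if_neg hc, spinSign_of_lt (by omega)]; ring
    · have hc : ¬ ((v.2.1 0).val = S ∧ 2 ≤ (v.2.2.2).val ∧ w'.1 = v.1 ∧ w'.2.1 = Site.shift v.2.1 0 ∧
          w'.2.2.2 = v.2.2.2) := fun h => hfr ⟨h.2.2.1.symm, h.2.2.2.2.symm⟩
      rw [if_neg hfr, if_neg hc]
  · by_cases hB : (w'.2.1 0).val = S ∧ v.2.1 = Site.shift w'.2.1 0
    · have htv' : (v.2.1 0).val = S + 1 := by rw [hB.2]; exact val_shift_zero_of_layer hL hS hB.1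
      have hA2 : ¬ ((v.2.1 0).val = S ∧ 2 ≤ (v.2.2.2).val ∧ w'.1 = v.1 ∧ w'.2.1 = Site.shift v.2.1 0 ∧
          w'.2.2.2 = v.2.2.2) := fun h => by have := h.1; omega
      rw [if_neg hA2, zero_add]
      by_cases hfr : v.1 = w'.1 ∧ v.2.2.2 = w'.2.2.2
      · rw [if_pos hfr, if_neg hA, if_pos hB]
        by_cases hr : (v.2.2.2).val < 2
        · have hr' : (w'.2.2.2).val < 2 := hfr.2 ▸ hr
          have hc : (w'.2.1 0).val = S ∧ (w'.2.2.2).val < 2 ∧ v.1 = w'.1 ∧ v.2.1 = Site.shift w'.2.1 0 ∧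
              v.2.2.2 = w'.2.2.2 := ⟨hB.1, hr', hfr.1, hB.2, hfr.2⟩
          rw [if_pos hc, ← hfr.2, spinSign_of_lt hr]; ring
        · have hc : ¬ ((w'.2.1 0).val = S ∧ (w'.2.2.2).val < 2 ∧ v.1 = w'.1 ∧ v.2.1 = Site.shift w'.2.1 0 ∧
              v.2.2.2 = w'.2.2.2) := fun h => hr (hfr.2.symm ▸ h.2.1)
          rw [if_neg hc, spinSign_of_le (by omega)]; ring
      · have hc : ¬ ((w'.2.1 0).val = S ∧ (w'.2.2.2).val < 2 ∧ v.1 = w'.1 ∧ v.2.1 = Site.shift w'.2.1 0 ∧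
            v.2.2.2 = w'.2.2.2) := fun h => hfr ⟨h.2.2.1, h.2.2.2.2⟩
        rw [if_neg hfr, if_neg hc]
    · have hc1 : ¬ ((v.2.1 0).val = S ∧ 2 ≤ (v.2.2.2).val ∧ w'.1 = v.1 ∧ w'.2.1 = Site.shift v.2.1 0 ∧
          w'.2.2.2 = v.2.2.2) := fun h => hA ⟨h.1, h.2.2.2.1⟩
      have hc2 : ¬ ((w'.2.1 0).val = S ∧ (w'.2.2.2).val < 2 ∧ v.1 = w'.1 ∧ v.2.1 = Site.shift w'.2.1 0 ∧
          v.2.2.2 = w'.2.2.2) := fun h => hB ⟨h.1, h.2.2.2.1⟩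
      rw [if_neg hc1, if_neg hc2, add_zero]
      split_ifs <;> rfl

include hL hS in
/-- **The crossing identity** (Montvay–Münster (4.96)/(4.103) after the Osterwalder–Seiler link split):
`Q_c(translateLayer S Y U) = Σ_{w ∈ layerGens S} 2 • ξ_w(negReflect U) · Θ'(ξ_w(splice_{layer}(U, Y)))`. [cite: MontvayMunster1994, §4.2.3 (4.96) and (4.103)] -/
theorem crossPart_translateLayer :
    crossPart (translateLayer S Y U) mq =
      ∑ w ∈ layerGens S, (2 : ℂ) • (xiVar w U.negReflect *
        fermiThetaRot (xiVar w (LatticeRP.splice (layerEdges S) (U, Y)))) := by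
  rw [crossPart, maskT_crossR_rotDirac_eq_sum hL hS U Y mq, quadratic_finset_sum]
  refine Finset.sum_congr rfl fun w hw => ?_
  rw [quadratic_smul, xiVar_mul_map_of_mem hL U Y hw]

end Crossing

end

end Literature.MathematicalPhysics.QuantumFieldTheory

/-!
## Part: The slice block of the rotated Wilson quark action: `Q₀ = Q^{lu} + Q^{uu} + Q^{ll}`, `Q^{lu} = φ(l A' u)`

Companion of `QCDSiteRPAction` (the rotated antiperiodic Wilson action `ψ̄M(U)ψ`, its slice block
`zeroPart`, the entries `rotDirac_apply_of_spinSign_eq`) and `QCDSiteRPSliceVars` (the slice indices,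
the substitution `slicePhi`, Montvay–Münster's positive matrix `B` and the slice coupling `sliceK`), for
the site-reflection positivity proof of lattice QCD with Wilson quarks (Montvay–Münster 1994 §4.2.3
(4.104)–(4.110)).  In the `γ₀`-diagonal frame the slice block of `M(U)` splits by the spin classes
of its two indices:

* `luPart` (both indices in the same class `r, s < 2` or `r, s ≥ 2`: the couplings `l A' u` between a
  LOWER and an UPPER slice generator), `uuPart` (`ψ̄_{r≥2} ψ_{s<2}`: both upper), `llPart` (both lower);
  `zeroPart_eq_add : Q₀ = Q^{lu} + Q^{uu} + Q^{ll}`, `fermiThetaRot_uuPart : Θ' Q^{uu}(U) = Q^{ll}(Θ'U)`;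
* **`luPart_eq_map_slicePhi`**: `Q^{lu}(U) = φ (ψ̄ (−sliceK U) ψ)` — the slice Gaussian is the image
  under the substitution of the abstract Gaussian with matrix `A' = −K`, `K = sliceK U mq ≻ 0`
  (Montvay–Münster (4.109)–(4.110): `B = 1 − κ(6 − W) ≻ 0`);
* the support statements `uuPart_mem`, `posPart_mem`: `Q^{uu}` and the positive block `Q₊` only involve
  positive-time and UPPER slice generators (Montvay–Münster: "`S₊` depends on the slice only through
  `ξ = P₊ψ₀`, `η`").

Everything is proved; no named fact. [cite: MontvayMunster1994, §4.2.3 (4.100)–(4.110)]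
-/

namespace Literature.MathematicalPhysics.QuantumFieldTheory

open Literature.Probability Literature.Probability.LatticeModels
open Literature.MathematicalPhysics.QuantumLattice
open Literature.MathematicalPhysics.QuantumLattice.GrassmannAlgebra
open WilsonRP
open scoped ComplexConjugate Matrix

noncomputable section

local notation "𝔾" => Matrix.specialUnitaryGroup (Fin 3) ℂ

variable {Nf L : ℕ} [NeZero L]

/-! ## Spin masks and the three slice parts -/

section Masks

/-- Keep the entries whose (rotated) spins are related by `ρ`. [folklore] -/
def maskS (ρ : Fin 4 → Fin 4 → Prop) [DecidableRel ρ] (A : Matrix (FermiIdx Nf L) (FermiIdx Nf L) ℂ) :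
    Matrix (FermiIdx Nf L) (FermiIdx Nf L) ℂ :=
  Matrix.of fun p q => if ρ (idxSpin p) (idxSpin q) then A p q else 0

/-- Entries of `maskS`. [folklore] -/
@[simp] theorem maskS_apply (ρ : Fin 4 → Fin 4 → Prop) [DecidableRel ρ] (A : Matrix (FermiIdx Nf L) (FermiIdx Nf L) ℂ)
    (p q : FermiIdx Nf L) : maskS ρ A p q = if ρ (idxSpin p) (idxSpin q) then A p q else 0 := rfl

/-- Same spin class (`ψ̄`-lower with `ψ`-upper, or `ψ̄`-upper with `ψ`-lower): the `l–u` couplings. [folklore] -/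
def sameR (r s : Fin 4) : Prop := (r.val < 2 ↔ s.val < 2)

/-- `ψ̄` upper (`r ≥ 2`) with `ψ` upper (`s < 2`). [folklore] -/
def uuR (r s : Fin 4) : Prop := 2 ≤ r.val ∧ s.val < 2

/-- `ψ̄` lower (`r < 2`) with `ψ` lower (`s ≥ 2`). [folklore] -/
def llR (r s : Fin 4) : Prop := r.val < 2 ∧ 2 ≤ s.val

/-- `sameR` is decidable. [folklore] -/
instance : DecidableRel sameR := fun _ _ => by unfold sameR; infer_instance
/-- `uuR` is decidable. [folklore] -/
instance : DecidableRel uuR := fun _ _ => by unfold uuR; infer_instance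
/-- `llR` is decidable. [folklore] -/
instance : DecidableRel llR := fun _ _ => by unfold llR; infer_instance

/-- The three spin masks exhaust a matrix. [folklore] -/
theorem maskS_split (A : Matrix (FermiIdx Nf L) (FermiIdx Nf L) ℂ) :
    A = maskS sameR A + maskS uuR A + maskS llR A := by
  ext p q
  simp only [Matrix.add_apply, maskS_apply, sameR, uuR, llR]
  by_cases h1 : (idxSpin p).val < 2 <;> by_cases h2 : (idxSpin q).val < 2
  · have h1' : ¬ 2 ≤ (idxSpin p).val := by omega
    simp [h1, h2, h1']
  · have h1' : ¬ 2 ≤ (idxSpin p).val := by omega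
    have h2' : 2 ≤ (idxSpin q).val := by omega
    simp [h1, h2, h1', h2']
  · have h1' : 2 ≤ (idxSpin p).val := by omega
    have h2' : ¬ 2 ≤ (idxSpin q).val := by omega
    simp [h1, h2, h1', h2']
  · have h1' : 2 ≤ (idxSpin p).val := by omega
    have h2' : 2 ≤ (idxSpin q).val := by omega
    simp [h1, h2, h1', h2']

variable (U : GaugeConfig 4 L 𝔾) (mq : Fin Nf → ℝ)

/-- The slice block of `M(U)`. [folklore] -/
def sliceMat : Matrix (FermiIdx Nf L) (FermiIdx Nf L) ℂ := maskT zeroR (rotDirac U mq)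

/-- **`Q^{lu}`**: the slice couplings between lower and upper generators. [cite: MontvayMunster1994, §4.2.3 (4.109)] -/
def luPart : FermiAlg Nf L := quadratic ℂ (maskS sameR (sliceMat U mq))

/-- **`Q^{uu}`**: the slice couplings among upper generators. [cite: MontvayMunster1994, §4.2.3 (4.100)] -/
def uuPart : FermiAlg Nf L := quadratic ℂ (maskS uuR (sliceMat U mq))

/-- **`Q^{ll}`**: the slice couplings among lower generators. [cite: MontvayMunster1994, §4.2.3 (4.100)] -/
def llPart : FermiAlg Nf L := quadratic ℂ (maskS llR (sliceMat U mq))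

/-- **`Q₀ = Q^{lu} + Q^{uu} + Q^{ll}`.** [folklore] -/
theorem zeroPart_eq_add : zeroPart U mq = luPart U mq + uuPart U mq + llPart U mq := by
  rw [zeroPart, luPart, uuPart, llPart, ← quadratic_add, ← quadratic_add, ← sliceMat, ← maskS_split]

/-- The reflection swaps the spin mask. [folklore] -/
theorem reflMatrix_maskS (ρ ρ' : Fin 4 → Fin 4 → Prop) [DecidableRel ρ] [DecidableRel ρ']
    (h : ∀ r s, ρ' r s ↔ ρ s r) (A : Matrix (FermiIdx Nf L) (FermiIdx Nf L) ℂ) :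
    reflMatrix (maskS ρ A) = maskS ρ' (reflMatrix A) := by
  ext p q
  simp only [reflMatrix, Matrix.of_apply, maskS_apply, idxSpin_idxRefl]
  by_cases hpq : ρ' (idxSpin p) (idxSpin q)
  · rw [if_pos hpq, if_pos ((h _ _).1 hpq)]
  · rw [if_neg hpq, if_neg (fun h' => hpq ((h _ _).2 h')), star_zero, mul_zero]

/-- **`Θ' Q^{uu}(U) = Q^{ll}(Θ'U)`** (`L` odd). [cite: MontvayMunster1994, §4.2.3 (4.106)] -/
theorem fermiThetaRot_uuPart (hL : Odd L) : fermiThetaRot (uuPart U mq) = llPart U.negReflect mq := by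
  rw [uuPart, llPart, fermiThetaRot_quadratic_eq, reflMatrix_maskS uuR llR (fun r s => by
    unfold uuR llR; tauto), sliceMat, sliceMat, reflMatrix_maskT zeroR zeroR
    (fun t t' ht ht' => zeroR_iff_zeroR_timeRefl ht ht'), reflMatrix_rotDirac hL]

end Masks

/-! ## Entries of the slice block at slice variables -/

section Entries

open SliceIdx

variable (U : GaugeConfig 4 L 𝔾) (mq : Fin Nf → ℝ)

omit [NeZero L] in
/-- No temporal forward hop inside the slice (`L > 1`). [folklore] -/
theorem hopF_zero_sliceSite (hL1 : 1 < L) (y y' : TorusSite 3 L) (a b : Fin 3) :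
    hopF U 0 (sliceSite y) a (sliceSite y') b = 0 := by
  haveI : Fact (1 < L) := ⟨hL1⟩
  rw [hopF, if_neg]
  intro h
  have := congrFun h 0
  rw [sliceSite_apply_zero, shift_apply_self, sliceSite_apply_zero, zero_add] at this
  exact one_ne_zero this.symm

omit [NeZero L] in
/-- No temporal backward hop inside the slice (`L > 1`). [folklore] -/
theorem hopB_zero_sliceSite (hL1 : 1 < L) (y y' : TorusSite 3 L) (a b : Fin 3) :
    hopB U 0 (sliceSite y) a (sliceSite y') b = 0 := by
  haveI : Fact (1 < L) := ⟨hL1⟩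
  rw [hopB, if_neg]
  intro h
  have := congrFun h 0
  rw [sliceSite_apply_zero, shift_apply_self, sliceSite_apply_zero, zero_add] at this
  exact one_ne_zero this.symm

omit [NeZero L] in
/-- A spatial forward hop inside the slice is the slice hopping matrix. [folklore] -/
theorem hopF_succ_sliceSite (j : Fin 3) (y y' : TorusSite 3 L) (a b : Fin 3) :
    hopF U j.succ (sliceSite y) a (sliceSite y') b = hopT U j (y, a) (y', b) := by
  rw [hopF, hopT_apply, shift_sliceSite, apLinkSign_of_ne_zero _ _ (Fin.succ_ne_zero j), one_mul]
  by_cases h : y' = y + Pi.single j 1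
  · rw [if_pos (by rw [h]), if_pos h]
  · rw [if_neg (fun e => h (sliceSite_injective e)), if_neg h]

omit [NeZero L] in
/-- A spatial backward hop inside the slice is the adjoint slice hopping matrix. [folklore] -/
theorem hopB_succ_sliceSite (j : Fin 3) (y y' : TorusSite 3 L) (a b : Fin 3) :
    hopB U j.succ (sliceSite y) a (sliceSite y') b = star (hopT U j (y', b) (y, a)) := by
  rw [hopB, hopT_apply, shift_sliceSite, apLinkSign_of_ne_zero _ _ (Fin.succ_ne_zero j), one_mul]
  by_cases h : y = y' + Pi.single j 1
  · rw [if_pos (by rw [h]), if_pos h, star_specialUnitary_apply]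
  · rw [if_neg (fun e => h (sliceSite_injective e)), if_neg h, star_zero]

/-- Equal spin classes have equal signs. [folklore] -/
theorem spinSign_eq_of_sameR {r s : Fin 4} (h : sameR r s) : spinSign r = spinSign s := by
  unfold sameR at h
  by_cases hr : r.val < 2
  · rw [spinSign_of_lt hr, spinSign_of_lt (h.1 hr)]
  · rw [spinSign_of_le (by omega), spinSign_of_le (by by_contra hs; exact hr (h.2 (by omega)))]

/-- The slice-coupling coefficient between two slice variables. [folklore] -/
def sliceCoef (j k : SliceIdx Nf L) : ℂ :=
  if j.flav = k.flav ∧ j.spin = k.spin then -2 * sliceB U (mq j.flav) (j.site, j.col) (k.site, k.col) else 0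

/-- **The slice block of `M(U)` between two slice variables of the same spin class is
`−2 δ_{fg} δ_{rs} B_f`** (`L > 1`). [cite: MontvayMunster1994, §4.2.3 (4.109)–(4.110)] -/
theorem rotDirac_qidx_qidx (hL1 : 1 < L) (j k : SliceIdx Nf L) (h : sameR j.spin k.spin) :
    rotDirac U mq j.qidx k.qidx = sliceCoef U mq j k := by
  rw [qidx, qidx, rotDirac_apply_of_spinSign_eq U mq j.qvar k.qvar (spinSign_eq_of_sameR h)
    (hopF_zero_sliceSite U hL1 _ _ _ _) (hopB_zero_sliceSite U hL1 _ _ _ _)]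
  simp only [qvar, sliceCoef, flav, site, col, spin]
  by_cases hfs : j.1 = k.1 ∧ j.2.2.2 = k.2.2.2
  · rw [if_pos hfs, if_pos hfs, sliceB_apply, Fin.sum_univ_succ]
    simp only [if_true, Fin.succ_ne_zero, if_false, hopF_succ_sliceSite, hopB_succ_sliceSite, zero_add]
    have hsite : (sliceSite j.2.1 = sliceSite k.2.1 ∧ j.2.2.1 = k.2.2.1) ↔ ((j.2.1, j.2.2.1) : ColourSite L) = (k.2.1, k.2.2.1) := by
      rw [Prod.mk.injEq, sliceSite_injective.eq_iff]
    by_cases hs : ((j.2.1, j.2.2.1) : ColourSite L) = (k.2.1, k.2.2.1)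
    · rw [if_pos (hsite.2 hs), if_pos hs]
    · rw [if_neg (fun e => hs (hsite.1 e)), if_neg hs]
  · rw [if_neg hfs, if_neg hfs]

/-- `sliceCoef` vanishes between different spin classes. [folklore] -/
theorem sliceCoef_eq_zero_of_not_sameR {j k : SliceIdx Nf L} (h : ¬ sameR j.spin k.spin) : sliceCoef U mq j k = 0 := by
  rw [sliceCoef, if_neg]
  rintro ⟨-, hs⟩
  exact h (by rw [hs]; exact Iff.rfl)

/-- Every slice-time index is a `qidx`. [folklore] -/
theorem exists_qidx_eq {i : FermiIdx Nf L} (hi : idxTime i = 0) : ∃ k : SliceIdx Nf L, k.qidx = i := by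
  set v := quarkEquiv.symm i with hv
  have hi' : i = quarkEquiv v := by simp [hv]
  rw [hi', idxTime_quarkEquiv, ZMod.val_eq_zero] at hi
  refine ⟨(v.1, Fin.tail v.2.1, v.2.2.1, v.2.2.2), ?_⟩
  rw [hi']
  simp only [qidx, qvar, flav, site, col, spin, sliceSite_tail _ hi, Prod.mk.eta]

/-- A sum over all quark indices of a function supported on the slice is a sum over slice indices. [folklore] -/
theorem sum_fermiIdx_eq_sum_sliceIdx {M : Type*} [AddCommMonoid M] (F : FermiIdx Nf L → M)
    (hF : ∀ i, idxTime i ≠ 0 → F i = 0) : ∑ i, F i = ∑ k : SliceIdx Nf L, F k.qidx := by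
  rw [← Finset.sum_image (f := F) (s := Finset.univ) (g := qidx) fun _ _ _ _ h => qidx_injective h]
  symm
  refine Finset.sum_subset (Finset.subset_univ _) fun i _ hi => hF i fun h0 => hi ?_
  obtain ⟨k, rfl⟩ := exists_qidx_eq h0
  exact Finset.mem_image_of_mem _ (Finset.mem_univ k)

/-- **`Q^{lu}` as a sum over pairs of slice indices.** [folklore] -/
theorem luPart_eq_sum (hL1 : 1 < L) :
    luPart U mq = ∑ j : SliceIdx Nf L, ∑ k : SliceIdx Nf L, sliceCoef U mq j k • (psiBar ℂ j.qidx * psi ℂ k.qidx) := by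
  rw [luPart, quadratic]
  have h0 : ∀ i i' : FermiIdx Nf L, idxTime i ≠ 0 ∨ idxTime i' ≠ 0 →
      maskS sameR (sliceMat U mq) i i' • (psiBar ℂ i * psi ℂ i') = 0 := by
    intro i i' hi
    simp only [maskS_apply, sliceMat, maskT_apply, zeroR]
    rcases hi with hi | hi <;> simp [hi]
  rw [sum_fermiIdx_eq_sum_sliceIdx (fun i => ∑ i', maskS sameR (sliceMat U mq) i i' • (psiBar ℂ i * psi ℂ i'))
    (fun i hi => Finset.sum_eq_zero fun i' _ => h0 i i' (Or.inl hi))]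
  refine Finset.sum_congr rfl fun j _ => ?_
  rw [sum_fermiIdx_eq_sum_sliceIdx (fun i' => maskS sameR (sliceMat U mq) j.qidx i' • (psiBar ℂ j.qidx * psi ℂ i'))
    (fun i' hi => h0 _ i' (Or.inr hi))]
  refine Finset.sum_congr rfl fun k _ => ?_
  simp only [maskS_apply, idxSpin_qidx, sliceMat, maskT_apply, idxTime_qidx, zeroR, and_self, if_true]
  by_cases h : sameR j.spin k.spin
  · rw [if_pos h, rotDirac_qidx_qidx U mq hL1 j k h]
  · rw [if_neg h, sliceCoef_eq_zero_of_not_sameR U mq h]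

end Entries

/-! ## `Q^{lu} = φ(ψ̄ (−K) ψ)` -/

section Identity

open SliceIdx

variable (U : GaugeConfig 4 L 𝔾) (mq : Fin Nf → ℝ)

/-- The images of the abstract generators in terms of `ψ̄`, `ψ`. [folklore] -/
theorem map_slicePhi_psi_eq (k : SliceIdx Nf L) :
    ExteriorAlgebra.map slicePhi (psi ℂ k) =
      if (k.spin).val < 2 then psi ℂ k.qidx else psiBar ℂ k.qidx := by
  rw [map_slicePhi_psi, emb]
  split_ifs <;> rfl

/-- The images of the abstract conjugate generators in terms of `ψ̄`, `ψ`. [folklore] -/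
theorem map_slicePhi_psiBar_eq (j : SliceIdx Nf L) :
    ExteriorAlgebra.map slicePhi (psiBar ℂ j) =
      if (j.spin).val < 2 then psiBar ℂ j.qidx else -psi ℂ j.qidx := by
  rw [map_slicePhi_psiBar, fermiThetaRot_gen, genSign_emb, reflGen_emb]
  by_cases h : (j.spin).val < 2
  · rw [if_pos h, if_pos h, spinSign_of_lt h, one_smul]; rfl
  · rw [if_neg h, if_neg h, spinSign_of_le (by omega), neg_one_smul]; rfl

/-- One term of `φ(ψ̄ (−K) ψ)`. [folklore] -/
theorem neg_sliceK_smul_map_mul_map (j k : SliceIdx Nf L) :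
    (-sliceK U mq) j k • (ExteriorAlgebra.map slicePhi (psiBar ℂ j) * ExteriorAlgebra.map slicePhi (psi ℂ k)) =
      if (j.spin).val < 2 then sliceCoef U mq j k • (psiBar ℂ j.qidx * psi ℂ k.qidx)
      else sliceCoef U mq k j • (psiBar ℂ k.qidx * psi ℂ j.qidx) := by
  rw [Matrix.neg_apply, sliceK_apply, map_slicePhi_psiBar_eq, map_slicePhi_psi_eq]
  by_cases hfs : j.flav = k.flav ∧ j.spin = k.spin
  · have hs : (j.spin).val < 2 ↔ (k.spin).val < 2 := by rw [hfs.2]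
    by_cases hj : (j.spin).val < 2
    · rw [if_pos hfs, if_pos hj, if_pos hj, if_pos (hs.1 hj), if_pos hj, sliceCoef, if_pos hfs]
      congr 1; ring
    · have hfs' : k.flav = j.flav ∧ k.spin = j.spin := ⟨hfs.1.symm, hfs.2.symm⟩
      have hk : ¬ (k.spin).val < 2 := fun h => hj (hs.2 h)
      rw [if_pos hfs, if_neg hj, if_neg hj, if_neg hk, if_neg hj, sliceCoef, if_pos hfs', hfs.1]
      simp only [neg_mul, psi_mul_psiBar, neg_neg, neg_smul]
  · have hfs' : ¬ (k.flav = j.flav ∧ k.spin = j.spin) := fun h => hfs ⟨h.1.symm, h.2.symm⟩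
    rw [if_neg hfs, neg_zero, zero_smul, sliceCoef, if_neg hfs, sliceCoef, if_neg hfs']
    simp

/-- **`Q^{lu}(U) = φ(ψ̄ (−K(U)) ψ)`**: the slice Gaussian is the substitution image of the abstract
Gaussian with matrix `A' = −sliceK U mq` (`L > 1`). [cite: MontvayMunster1994, §4.2.3 (4.109)–(4.110)] -/
theorem luPart_eq_map_slicePhi (hL1 : 1 < L) :
    luPart U mq = ExteriorAlgebra.map slicePhi (quadratic ℂ (-sliceK U mq)) := by
  rw [luPart_eq_sum U mq hL1, quadratic, map_sum]
  conv_rhs =>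
    arg 2; ext j; rw [map_sum]; arg 2; ext k; rw [map_smul, map_mul, neg_sliceK_smul_map_mul_map]
  -- regroup the `r ≥ 2` terms by swapping the summation indices
  have hsplit : ∀ j k : SliceIdx Nf L,
      (if (j.spin).val < 2 then sliceCoef U mq j k • (psiBar ℂ j.qidx * psi ℂ k.qidx)
        else sliceCoef U mq k j • (psiBar ℂ k.qidx * psi ℂ j.qidx)) =
      (if (j.spin).val < 2 then sliceCoef U mq j k • (psiBar ℂ j.qidx * psi ℂ k.qidx) else 0) +
      (if (j.spin).val < 2 then 0 else sliceCoef U mq k j • (psiBar ℂ k.qidx * psi ℂ j.qidx)) := by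
    intro j k; split_ifs <;> simp
  simp only [hsplit, Finset.sum_add_distrib]
  rw [Finset.sum_comm (f := fun j k => if (j.spin).val < 2 then (0 : FermiAlg Nf L)
    else sliceCoef U mq k j • (psiBar ℂ k.qidx * psi ℂ j.qidx))]
  rw [← Finset.sum_add_distrib]
  refine Finset.sum_congr rfl fun j _ => ?_
  rw [← Finset.sum_add_distrib]
  refine Finset.sum_congr rfl fun k _ => ?_
  -- termwise: `[j<2] c_{jk} + [k≥2] c_{jk} = c_{jk}`
  by_cases hj : (j.spin).val < 2 <;> by_cases hk : (k.spin).val < 2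
  · rw [if_pos hj, if_pos hk, add_zero]
  · rw [if_pos hj, if_neg hk, sliceCoef_eq_zero_of_not_sameR U mq (fun h : sameR j.spin k.spin => hk (h.1 hj)),
      zero_smul, zero_add]
  · rw [if_neg hj, if_pos hk, sliceCoef_eq_zero_of_not_sameR U mq (fun h : sameR j.spin k.spin => hj (h.2 hk)),
      zero_smul, add_zero]
  · rw [if_neg hj, if_neg hk, zero_add]

end Identity

/-! ## Supports: the positive block and `Q^{uu}` involve only upper slice generators -/

section Support

open SliceIdx

variable (U : GaugeConfig 4 L 𝔾) (mq : Fin Nf → ℝ)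

/-- A `ψ̄ψ` term with generators outside `T` is a spectator of `T`. [folklore] -/
theorem smul_psiBar_mul_psi_mem {T : Finset (FermiIdx Nf L ⊕ₗ FermiIdx Nf L)} {c : ℂ} {p q : FermiIdx Nf L}
    (h : c ≠ 0 → toLex (Sum.inl p) ∉ T ∧ toLex (Sum.inr q) ∉ T) :
    c • (psiBar ℂ p * psi ℂ q) ∈ spectatorSubalgebra ℂ T := by
  by_cases hc : c = 0
  · rw [hc, zero_smul]; exact Subalgebra.zero_mem _
  · obtain ⟨hp, hq⟩ := h hc
    exact Subalgebra.smul_mem _ (Subalgebra.mul_mem _ (gen_mem_spectatorSubalgebra ℂ hp)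
      (gen_mem_spectatorSubalgebra ℂ hq)) _

/-- **`Q^{uu}` is a spectator of `N ∪ L₀`** (it involves only upper slice generators). [folklore] -/
theorem uuPart_mem : uuPart U mq ∈ spectatorSubalgebra ℂ (negGens Nf L ∪ lowerGens Nf L) := by
  rw [uuPart, quadratic]
  refine Subalgebra.sum_mem _ fun p _ => Subalgebra.sum_mem _ fun q _ => smul_psiBar_mul_psi_mem fun hc => ?_
  rw [maskS_apply, sliceMat, maskT_apply] at hc
  have h1 : uuR (idxSpin p) (idxSpin q) := by by_contra h; exact hc (by rw [if_neg h])
  have h2 : zeroR (idxTime p) (idxTime q) := by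
    by_contra h; exact hc (by rw [if_pos h1, if_neg h])
  obtain ⟨hp0, hq0⟩ := h2
  obtain ⟨hpu, hqu⟩ := h1
  constructor
  · simp only [Finset.mem_union, mem_negGens, mem_lowerGens, genTimeT, genIdx_inl, isUpper_inl, not_or]
    exact ⟨by omega, fun h => h.2 hpu⟩
  · simp only [Finset.mem_union, mem_negGens, mem_lowerGens, genTimeT, genIdx_inr, isUpper_inr, not_or]
    exact ⟨by omega, fun h => h.2 hqu⟩


/-- **`Q^{lu}` is a spectator of `P ∪ N`** (it involves only slice generators). [folklore] -/
theorem luPart_mem : luPart U mq ∈ spectatorSubalgebra ℂ (posGens Nf L ∪ negGens Nf L) := by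
  rw [luPart, quadratic]
  refine Subalgebra.sum_mem _ fun p _ => Subalgebra.sum_mem _ fun q _ => smul_psiBar_mul_psi_mem fun hc => ?_
  rw [maskS_apply, sliceMat, maskT_apply] at hc
  have h1 : sameR (idxSpin p) (idxSpin q) := by by_contra h; exact hc (by rw [if_neg h])
  have h2 : zeroR (idxTime p) (idxTime q) := by
    by_contra h; exact hc (by rw [if_pos h1, if_neg h])
  obtain ⟨hp0, hq0⟩ := h2
  constructor
  · rw [← mem_zeroGens_iff_not_mem, mem_zeroGens]; simpa [genTimeT] using hp0
  · rw [← mem_zeroGens_iff_not_mem, mem_zeroGens]; simpa [genTimeT] using hq0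

variable {S : ℕ} (hL : L = 2 * S + 1) (hS : 1 ≤ S)
include hL hS

/-- **An entry of the positive block from the slice is a forward temporal hop, hence has an upper
`ψ̄`-spin** (`r ≥ 2`). [cite: MontvayMunster1994, §4.2.3 (4.102)] -/
theorem spin_of_posR_slice_left (v w : QuarkVar Nf L) (hpos : posR L (v.2.1 0).val (w.2.1 0).val)
    (hv0 : (v.2.1 0).val = 0) (hne : rotDirac U mq (quarkEquiv v) (quarkEquiv w) ≠ 0) : 2 ≤ (v.2.2.2).val := by
  have hhalf : L / 2 = S := by omega
  have htw := ZMod.val_lt (w.2.1 0)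
  unfold posR at hpos
  rw [hhalf] at hpos
  have hw1 : 1 ≤ (w.2.1 0).val := by omega
  -- the only hop from time `0` to a positive time is the forward temporal one
  have hxy : ¬ (v.2.1 = w.2.1 ∧ v.2.2.1 = w.2.2.1) := fun h => by
    have := congrArg (fun y : TorusSite 4 L => (y 0).val) h.1; omega
  have hFj : ∀ μ, μ ≠ 0 → hopF U μ v.2.1 v.2.2.1 w.2.1 w.2.2.1 = 0 := fun μ hμ => by
    rw [hopF, if_neg]
    intro h
    have := congrArg (fun y : TorusSite 4 L => (y 0).val) h
    simp only [shift_apply_of_ne _ (Ne.symm hμ)] at this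
    omega
  have hBμ : ∀ μ, hopB U μ v.2.1 v.2.2.1 w.2.1 w.2.2.1 = 0 := fun μ => by
    rw [hopB, if_neg]
    intro h
    have h0 := congrArg (fun y : TorusSite 4 L => (y 0).val) h
    by_cases hμ : μ = 0
    · subst hμ
      haveI : Fact (1 < L) := ⟨by omega⟩
      rw [shift_apply_self, ZMod.val_add, ZMod.val_one] at h0
      by_cases hlt : (w.2.1 0).val + 1 < L
      · rw [Nat.mod_eq_of_lt hlt] at h0; omega
      · have heq : (w.2.1 0).val + 1 = L := by omega
        rw [heq, Nat.mod_self] at h0; omega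
    · rw [shift_apply_of_ne _ (Ne.symm hμ)] at h0; omega
  rw [rotDirac_apply_forward U mq v w hxy hFj hBμ] at hne
  by_contra hr
  push Not at hr
  rw [spinSign_of_lt hr, sub_self, zero_mul, ite_self] at hne
  exact hne rfl

/-- **An entry of the positive block into the slice is a backward temporal hop, hence has a lower
`ψ`-spin** (`s < 2`). [cite: MontvayMunster1994, §4.2.3 (4.102)] -/
theorem spin_of_posR_slice_right (v w : QuarkVar Nf L) (hpos : posR L (v.2.1 0).val (w.2.1 0).val)
    (hw0 : (w.2.1 0).val = 0) (hne : rotDirac U mq (quarkEquiv v) (quarkEquiv w) ≠ 0) : (w.2.2.2).val < 2 := by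
  have hhalf : L / 2 = S := by omega
  have htv := ZMod.val_lt (v.2.1 0)
  unfold posR at hpos
  rw [hhalf] at hpos
  have hv1 : 1 ≤ (v.2.1 0).val := by omega
  have hxy : ¬ (v.2.1 = w.2.1 ∧ v.2.2.1 = w.2.2.1) := fun h => by
    have := congrArg (fun y : TorusSite 4 L => (y 0).val) h.1; omega
  have hBj : ∀ μ, μ ≠ 0 → hopB U μ v.2.1 v.2.2.1 w.2.1 w.2.2.1 = 0 := fun μ hμ => by
    rw [hopB, if_neg]
    intro h
    have := congrArg (fun y : TorusSite 4 L => (y 0).val) h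
    simp only [shift_apply_of_ne _ (Ne.symm hμ)] at this
    omega
  have hFμ : ∀ μ, hopF U μ v.2.1 v.2.2.1 w.2.1 w.2.2.1 = 0 := fun μ => by
    rw [hopF, if_neg]
    intro h
    have h0 := congrArg (fun y : TorusSite 4 L => (y 0).val) h
    by_cases hμ : μ = 0
    · subst hμ
      haveI : Fact (1 < L) := ⟨by omega⟩
      rw [shift_apply_self, ZMod.val_add, ZMod.val_one] at h0
      by_cases hlt : (v.2.1 0).val + 1 < L
      · rw [Nat.mod_eq_of_lt hlt] at h0; omega
      · have heq : (v.2.1 0).val + 1 = L := by omega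
        rw [heq, Nat.mod_self] at h0; omega
    · rw [shift_apply_of_ne _ (Ne.symm hμ)] at h0; omega
  rw [rotDirac_apply_backward U mq v w hxy hFμ hBj] at hne
  by_contra hr
  push Not at hr
  have hrs : v.2.2.2 = w.2.2.2 := by
    by_contra hne'
    have hc' : ¬ (v.1 = w.1 ∧ v.2.2.2 = w.2.2.2) := fun h => hne' h.2
    exact hne (by rw [if_neg hc'])
  rw [hrs, spinSign_of_le hr] at hne
  exact hne (by simp)

/-- **The positive block `Q₊` is a spectator of `N ∪ L₀`**: it involves only positive-time generators
and the UPPER slice generators `ψ̄_{0,r≥2}`, `ψ_{0,s<2}`. [cite: MontvayMunster1994, §4.2.3 (4.100)–(4.102)] -/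
theorem posPart_mem : posPart U mq ∈ spectatorSubalgebra ℂ (negGens Nf L ∪ lowerGens Nf L) := by
  have hhalf : L / 2 = S := by omega
  rw [posPart, quadratic]
  refine Subalgebra.sum_mem _ fun p _ => Subalgebra.sum_mem _ fun q' _ => smul_psiBar_mul_psi_mem fun hc => ?_
  obtain ⟨v, rfl⟩ := quarkEquiv.surjective p
  obtain ⟨w, rfl⟩ := quarkEquiv.surjective q'
  rw [maskT_apply, idxTime_quarkEquiv, idxTime_quarkEquiv] at hc
  have hpos : posR L (v.2.1 0).val (w.2.1 0).val := by by_contra h; exact hc (by rw [if_neg h])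
  rw [if_pos hpos] at hc
  have hpos' := hpos
  unfold posR at hpos'
  rw [hhalf] at hpos'
  constructor
  · simp only [Finset.mem_union, mem_negGens, mem_lowerGens, genTimeT, genIdx_inl, isUpper_inl, idxTime_quarkEquiv,
      idxSpin_quarkEquiv, not_or, not_and, not_not, hhalf]
    exact ⟨by omega, fun hv0 => spin_of_posR_slice_left U mq hL hS v w hpos hv0 hc⟩
  · simp only [Finset.mem_union, mem_negGens, mem_lowerGens, genTimeT, genIdx_inr, isUpper_inr, idxTime_quarkEquiv,
      idxSpin_quarkEquiv, not_or, not_and, not_lt, hhalf]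
    refine ⟨by omega, fun hw0 => ?_⟩
    have := spin_of_posR_slice_right U mq hL hS v w hpos hw0 hc
    omega

end Support

end

end Literature.MathematicalPhysics.QuantumFieldTheory

/-!
## Part: The reflection-positivity integrand of lattice QCD in the `γ₀`-diagonal frame, under the link split

Companion of `QCDSiteRPAction`, Part SliceAction (above), Part Crossing (above) for the site-reflection
positivity proof of lattice QCD with Wilson quarks on the odd torus (Montvay–Münster 1994 §4.2.3
(4.100)–(4.107); Lüscher 1977 §3).  For a positive-time observable `A` the Grassmann integrand of
`⟨A · ΘA⟩_AP` is brought to the form to which the abstract cone expansion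
(`GrassmannAlgebra.mul_map_mul_ordProd_cone`) and the slice pairing
(`GrassmannAlgebra.berezin_mul_map_mul_eq_top`, `map_pairing_gaussian_eq`) apply:

* `fermiIntegral_osPair_eq` — `∫ A(V)·(ΘA)(V)·e^{−ψ̄D^{AP}(V)ψ} = det R · ∫ 𝐀(V) · Θ'(𝐀(Θ'V)) ·
  e^{ψ̄M(V)ψ}` with `𝐀(W) = R'(A placed on the torus)` (`rotObs`), `Θ' = fermiThetaRot`;
* the gauge-dependence lemmas `rotObs_congr`, `posPart_congr`, `sliceMat_congr` (the positive-time
  observable and the blocks of the action depend on the positive links / the slice links only) and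
  their consequences under the split `translateLayer S Y U` and the site reflection;
* **`osIntegrand_translateLayer`** — for `V = translateLayer S Y U`:
  `𝐀(V) Θ'(𝐀(Θ'V)) e^{ψ̄M(V)ψ} = (G · Θ'H · ∏_{w ∈ layer}↑ (1 + 2 ξ_w(Θ'U) Θ'ξ_w(z))) · e^{Q^{lu}(U)}` with
  `G = 𝐀(U) e^{Q₊(U)} e^{Q^{uu}(U)}`, `H = 𝐀(Θ'U) e^{Q₊(Θ'U)} e^{Q^{uu}(U)}`, `z = splice_{layer}(U, Y)`
  (Montvay–Münster (4.104)–(4.107): `e^{−S} = e^{−S₊} Θ(e^{−S₊}) e^{ψ̄₀Bψ₀}` times the crossing factor).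

Everything is proved; no named fact. [cite: MontvayMunster1994, §4.2.3 (4.100)–(4.107)]
-/

namespace Literature.MathematicalPhysics.QuantumLattice

namespace GrassmannAlgebra

open scoped ComplexConjugate

variable {ι : Type*}

/-- **A reflection commutes with the exponential** of a nilpotent element (its coefficients `1/k!`
are real). [folklore] -/
theorem Reflection.map_grassmannExp (Θ : Reflection ι) {a : GrassmannAlgebra ℂ ι} (ha : IsNilpotent a) :
    Θ (grassmannExp a) = grassmannExp (Θ a) := by
  obtain ⟨n, hn⟩ := ha
  have hn' : (Θ a) ^ n = 0 := by rw [← Θ.map_pow, hn, Θ.map_zero]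
  rw [grassmannExp, grassmannExp, IsNilpotent.exp_eq_sum hn, IsNilpotent.exp_eq_sum hn', Θ.map_sum]
  refine Finset.sum_congr rfl fun k _ => ?_
  rw [← IsScalarTower.algebraMap_smul ℂ (k.factorial : ℚ)⁻¹ (a ^ k), Θ.map_smul, Θ.map_pow,
    ← IsScalarTower.algebraMap_smul ℂ (k.factorial : ℚ)⁻¹ (Θ a ^ k)]
  congr 1
  rw [eq_ratCast (algebraMap ℚ ℂ), map_ratCast]

/-- The exponential of an element of a subalgebra lies in it. [folklore] -/
theorem grassmannExp_mem {S : Subalgebra ℂ (GrassmannAlgebra ℂ ι)} {a : GrassmannAlgebra ℂ ι} (ha : a ∈ S) :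
    grassmannExp a ∈ S := by
  rw [grassmannExp, IsNilpotent.exp]
  refine Subalgebra.sum_mem _ fun k _ => ?_
  rw [← IsScalarTower.algebraMap_smul ℂ (k.factorial : ℚ)⁻¹ (a ^ k)]
  exact Subalgebra.smul_mem _ (Subalgebra.pow_mem _ ha _) _

/-- The exponential of a sum of two commuting nilpotents. [folklore] -/
theorem grassmannExp_add {a b : GrassmannAlgebra ℂ ι} (h : Commute a b) (ha : IsNilpotent a) (hb : IsNilpotent b) :
    grassmannExp (a + b) = grassmannExp a * grassmannExp b :=
  IsNilpotent.exp_add_of_commute h ha hb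

/-- The exponential of an even nilpotent element is even. [folklore] -/
theorem grassmannExp_even {a : GrassmannAlgebra ℂ ι} (ha : a ∈ evenOdd ℂ (ι := ι) 0) (hn : IsNilpotent a) :
    grassmannExp a ∈ evenOdd ℂ (ι := ι) 0 :=
  grassmannExp_mem_evenOdd_zero ℂ ha hn

end GrassmannAlgebra

end Literature.MathematicalPhysics.QuantumLattice

namespace Literature.MathematicalPhysics.QuantumFieldTheory

open Literature.Probability Literature.Probability.LatticeModels
open Literature.MathematicalPhysics.QuantumLattice
open Literature.MathematicalPhysics.QuantumLattice.GrassmannAlgebra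
open WilsonNegRP WilsonSiteRP WilsonRP
open scoped ComplexConjugate Matrix

noncomputable section

local notation "𝔾" => Matrix.specialUnitaryGroup (Fin 3) ℂ

variable {Nf L : ℕ} [NeZero L]

/-! ## The rotated observable and the frame form of the integrand -/

section RotObs

variable {R : ℕ} (A : QCDLatticeObservable Nf R)

/-- **The rotated, torus-placed observable** `𝐀(W) = R' (A placed at the origin of the torus)`. [folklore] -/
def rotObs (W : GaugeConfig 4 L 𝔾) : FermiAlg Nf L := spinUnrot (A.onTorus L 0 W)

/-- **The OS pairing integrand in the frame**:
`∫ A(V)·(ΘA)(V)·e^{−ψ̄D^{AP}(V)ψ} = det R · ∫ 𝐀(V) Θ'(𝐀(Θ'V)) e^{ψ̄M(V)ψ}`. [cite: MontvayMunster1994, §4.2.3 (4.99)–(4.100)] -/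
theorem fermiIntegral_osPair_eq (V : GaugeConfig 4 L 𝔾) (mq : Fin Nf → ℝ) :
    fermiIntegral (A.onTorus L 0 V * A.osAdjoint.onTorus L 0 V * fermiBoltzmannAP V mq) =
      LinearMap.det (blockSubst ℂ (spinBlock (Nf := Nf) (L := L) ((2 : ℂ)⁻¹ • spinWᴴ))
          (spinBlock ((2 : ℂ)⁻¹ • spinWᵀ))) *
        fermiIntegral (rotObs A V * fermiThetaRot (rotObs A V.negReflect) *
          grassmannExp (quadratic ℂ (rotDirac V mq))) := by
  rw [fermiIntegral_eq_det_mul_spinUnrot, map_mul spinUnrot, map_mul spinUnrot, osAdjoint_onTorus_zero,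
    spinUnrot_torusTheta, spinUnrot_fermiBoltzmannAP_eq]
  rfl

end RotObs

/-! ## Gauge dependence of the pieces -/

section Depends

variable {S : ℕ} (hL : L = 2 * S + 1) (hS : 1 ≤ S)

variable (S) in
/-- **The positive links**: temporal links based at times `0 … S−1` and spatial links at times
`1 … S` (all links between sites of times `≤ S`, not both in the slice). [folklore] -/
def posLinks : Finset (Edge 4 L) :=
  Finset.univ.filter fun e => (e.2 = 0 ∧ (e.1 0).val + 1 ≤ S) ∨ (e.2 ≠ 0 ∧ 1 ≤ (e.1 0).val ∧ (e.1 0).val ≤ S)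

/-- Membership in `posLinks`. [folklore] -/
theorem mem_posLinks {e : Edge 4 L} :
    e ∈ posLinks S ↔ (e.2 = 0 ∧ (e.1 0).val + 1 ≤ S) ∨ (e.2 ≠ 0 ∧ 1 ≤ (e.1 0).val ∧ (e.1 0).val ≤ S) := by
  unfold posLinks
  rw [Finset.mem_filter]
  exact ⟨fun h => h.2, fun h => ⟨Finset.mem_univ _, h⟩⟩

include hL hS in
/-- **The positive block depends on the positive links only.** [folklore] -/
theorem posPart_congr (mq : Fin Nf → ℝ) {U U' : GaugeConfig 4 L 𝔾} (h : ∀ e ∈ posLinks S, U e = U' e) :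
    posPart U mq = posPart U' mq := by
  have hhalf : L / 2 = S := by omega
  suffices hM : maskT (posR L) (rotDirac U mq) = maskT (posR L) (rotDirac U' mq) by rw [posPart, posPart, hM]
  ext p q'
  obtain ⟨v, rfl⟩ := quarkEquiv.surjective p
  obtain ⟨w, rfl⟩ := quarkEquiv.surjective q'
  rw [maskT_apply, maskT_apply, idxTime_quarkEquiv, idxTime_quarkEquiv]
  by_cases hpos : posR L (v.2.1 0).val (w.2.1 0).val
  · rw [if_pos hpos, if_pos hpos]
    unfold posR at hpos
    rw [hhalf] at hpos
    have htv := ZMod.val_lt (v.2.1 0)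
    have htw := ZMod.val_lt (w.2.1 0)
    refine rotDirac_congr mq v w (fun μ hμ => h _ ?_) (fun μ hμ => h _ ?_)
    · rw [mem_posLinks]
      have h0 := congrArg (fun y : TorusSite 4 L => (y 0).val) hμ
      by_cases hm : μ = 0
      · subst hm
        rw [val_shift_zero hL hS] at h0
        have hle : (v.2.1 0).val + 1 ≤ S := by
          by_cases hlt : (v.2.1 0).val + 1 < L
          · rw [Nat.mod_eq_of_lt hlt] at h0; omega
          · have heq : (v.2.1 0).val + 1 = L := by omega
            rw [heq, Nat.mod_self] at h0; omega
        exact Or.inl ⟨rfl, hle⟩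
      · rw [shift_apply_zero_of_ne _ hm] at h0
        have h1 : 1 ≤ (v.2.1 0).val := by omega
        have h2 : (v.2.1 0).val ≤ S := by omega
        exact Or.inr ⟨hm, h1, h2⟩
    · rw [mem_posLinks]
      have h0 := congrArg (fun y : TorusSite 4 L => (y 0).val) hμ
      by_cases hm : μ = 0
      · subst hm
        rw [val_shift_zero hL hS] at h0
        have hle : (w.2.1 0).val + 1 ≤ S := by
          by_cases hlt : (w.2.1 0).val + 1 < L
          · rw [Nat.mod_eq_of_lt hlt] at h0; omega
          · have heq : (w.2.1 0).val + 1 = L := by omega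
            rw [heq, Nat.mod_self] at h0; omega
        exact Or.inl ⟨rfl, hle⟩
      · rw [shift_apply_zero_of_ne _ hm] at h0
        have h1 : 1 ≤ (w.2.1 0).val := by omega
        have h2 : (w.2.1 0).val ≤ S := by omega
        exact Or.inr ⟨hm, h1, h2⟩
  · rw [if_neg hpos, if_neg hpos]

include hL hS in
/-- **The slice block depends on the slice links only.** [folklore] -/
theorem sliceMat_congr (mq : Fin Nf → ℝ) {U U' : GaugeConfig 4 L 𝔾} (h : ∀ e ∈ (sliceZeroEdges : Finset (Edge 4 L)), U e = U' e) :
    sliceMat U mq = sliceMat U' mq := by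
  rw [sliceMat, sliceMat]
  ext p q'
  obtain ⟨v, rfl⟩ := quarkEquiv.surjective p
  obtain ⟨w, rfl⟩ := quarkEquiv.surjective q'
  rw [maskT_apply, maskT_apply, idxTime_quarkEquiv, idxTime_quarkEquiv]
  by_cases hz : zeroR (v.2.1 0).val (w.2.1 0).val
  · rw [if_pos hz, if_pos hz]
    obtain ⟨hv0, hw0⟩ := hz
    refine rotDirac_congr mq v w (fun μ hμ => h _ ?_) (fun μ hμ => h _ ?_)
    · have h0 := congrArg (fun y : TorusSite 4 L => (y 0).val) hμ
      by_cases hm : μ = 0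
      · subst hm
        rw [val_shift_zero hL hS, hv0] at h0
        rw [Nat.mod_eq_of_lt (by omega)] at h0; omega
      · simp only [sliceZeroEdges, Finset.mem_filter, Finset.mem_univ, true_and]
        exact ⟨hm, hv0⟩
    · have h0 := congrArg (fun y : TorusSite 4 L => (y 0).val) hμ
      by_cases hm : μ = 0
      · subst hm
        rw [val_shift_zero hL hS, hw0] at h0
        rw [Nat.mod_eq_of_lt (by omega)] at h0; omega
      · simp only [sliceZeroEdges, Finset.mem_filter, Finset.mem_univ, true_and]
        exact ⟨hm, hw0⟩
  · rw [if_neg hz, if_neg hz]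

include hL hS in
/-- The slice parts depend on the slice links only. [folklore] -/
theorem uuPart_congr (mq : Fin Nf → ℝ) {U U' : GaugeConfig 4 L 𝔾} (h : ∀ e ∈ (sliceZeroEdges : Finset (Edge 4 L)), U e = U' e) :
    uuPart U mq = uuPart U' mq := by
  rw [uuPart, uuPart, sliceMat_congr hL hS mq h]

include hL hS in
/-- The slice parts depend on the slice links only. [folklore] -/
theorem luPart_congr (mq : Fin Nf → ℝ) {U U' : GaugeConfig 4 L 𝔾} (h : ∀ e ∈ (sliceZeroEdges : Finset (Edge 4 L)), U e = U' e) :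
    luPart U mq = luPart U' mq := by
  rw [luPart, luPart, sliceMat_congr hL hS mq h]

include hL hS in
/-- The slice parts depend on the slice links only. [folklore] -/
theorem zeroPart_congr (mq : Fin Nf → ℝ) {U U' : GaugeConfig 4 L 𝔾} (h : ∀ e ∈ (sliceZeroEdges : Finset (Edge 4 L)), U e = U' e) :
    zeroPart U mq = zeroPart U' mq := by
  rw [zeroPart, zeroPart, ← sliceMat, ← sliceMat, sliceMat_congr hL hS mq h]

/-- The site reflection does not move the slice links. [folklore] -/
theorem negReflect_apply_of_mem_sliceZeroEdges (U : GaugeConfig 4 L 𝔾) {e : Edge 4 L}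
    (he : e ∈ (sliceZeroEdges : Finset (Edge 4 L))) : U.negReflect e = U e := by
  simp only [sliceZeroEdges, Finset.mem_filter, Finset.mem_univ, true_and] at he
  obtain ⟨x, i⟩ := e
  obtain ⟨hi, hx⟩ := he
  simp only at hi hx
  have hxr : Site.negReflect x = x := by
    funext k
    by_cases hk : k = 0
    · subst hk; rw [WilsonSiteRP.negReflect_apply_zero, (ZMod.val_eq_zero _).1 hx, neg_zero]
    · rw [WilsonSiteRP.negReflect_apply_of_ne _ hk]
  rw [WilsonSiteRP.negReflect_apply, siteEdgeReflect, if_neg hi, if_neg hi]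
  show U (Site.negReflect x, i) = U (x, i)
  rw [hxr]

include hL hS in
/-- `Q^{uu}(Θ'U) = Q^{uu}(U)`. [folklore] -/
theorem uuPart_negReflect (U : GaugeConfig 4 L 𝔾) (mq : Fin Nf → ℝ) : uuPart U.negReflect mq = uuPart U mq :=
  uuPart_congr hL hS mq fun _ he => negReflect_apply_of_mem_sliceZeroEdges U he

include hL hS in
/-- `Q^{ll}(U) = Θ'(Q^{uu}(U))` on the odd torus. [cite: MontvayMunster1994, §4.2.3 (4.106)] -/
theorem llPart_eq_map_uuPart (U : GaugeConfig 4 L 𝔾) (mq : Fin Nf → ℝ) :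
    llPart U mq = fermiThetaRot (uuPart U mq) := by
  rw [fermiThetaRot_uuPart U mq ⟨S, hL⟩, llPart, llPart,
    sliceMat_congr hL hS mq (fun _ he => negReflect_apply_of_mem_sliceZeroEdges U he)]

omit [NeZero L] in
/-- The split field agrees with `U` off the layer. [folklore] -/
theorem translateLayer_apply_of_not_layer (Y U : GaugeConfig 4 L 𝔾) {e : Edge 4 L} (he : ¬ (e.2 = 0 ∧ (e.1 0).val = S)) :
    translateLayer S Y U e = U e := by
  simp only [translateLayer, he, if_false, mul_one]

/-- The splice agrees with `U` off the layer. [folklore] -/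
theorem splice_apply_of_not_layer (U Y : GaugeConfig 4 L 𝔾) {e : Edge 4 L} (he : ¬ (e.2 = 0 ∧ (e.1 0).val = S)) :
    LatticeRP.splice (layerEdges S) (U, Y) e = U e := by
  rw [LatticeRP.splice_apply, if_neg]
  simpa [layerEdges] using he

/-- Positive links are not layer links. [folklore] -/
theorem not_layer_of_mem_posLinks {e : Edge 4 L} (he : e ∈ posLinks S) : ¬ (e.2 = 0 ∧ (e.1 0).val = S) := by
  rw [mem_posLinks] at he
  rintro ⟨h2, hv⟩
  rcases he with ⟨_, h⟩ | ⟨h, _⟩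
  · omega
  · exact h h2

/-- Slice links are not layer links. [folklore] -/
theorem not_layer_of_mem_sliceZeroEdges {e : Edge 4 L} (he : e ∈ (sliceZeroEdges : Finset (Edge 4 L))) :
    ¬ (e.2 = 0 ∧ (e.1 0).val = S) := by
  simp only [sliceZeroEdges, Finset.mem_filter, Finset.mem_univ, true_and] at he
  exact fun h => he.1 h.1

include hL hS in
/-- **The reflection of a positive link is a link of the negative side.** [folklore] -/
theorem siteEdgeReflect_mem_negSide {e : Edge 4 L} (he : e ∈ posLinks S) : siteEdgeReflect e ∈ negSideEdges S := by
  haveI : Fact (1 < L) := ⟨by omega⟩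
  simp only [negSideEdges, Finset.mem_filter, Finset.mem_univ, true_and]
  obtain ⟨x, i⟩ := e
  rw [mem_posLinks] at he
  simp only at he
  have hxL := ZMod.val_lt (x 0)
  rcases he with ⟨hi, hx⟩ | ⟨hi, hx1, hxS⟩
  · subst hi
    simp only [siteEdgeReflect, if_true, WilsonSiteRP.negReflect_apply_zero, shift_apply_self]
    have hv : (x 0 + 1 : ZMod L).val = (x 0).val + 1 := by
      rw [ZMod.val_add, ZMod.val_one, Nat.mod_eq_of_lt (by omega)]
    have hne : (x 0 + 1 : ZMod L) ≠ 0 := fun h => by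
      have := congrArg ZMod.val h; rw [hv, ZMod.val_zero] at this; omega
    rw [ZMod.neg_val, if_neg hne, hv]
    omega
  · simp only [siteEdgeReflect, hi, if_false, WilsonSiteRP.negReflect_apply_zero]
    have hne : (x 0 : ZMod L) ≠ 0 := fun h => by rw [h, ZMod.val_zero] at hx1; omega
    rw [ZMod.neg_val, if_neg hne]
    omega

include hL hS in
/-- The site-reflected fields of two configurations agreeing on the negative side agree on the
positive links. [folklore] -/
theorem negReflect_apply_eq_of_mem_posLinks {W W' : GaugeConfig 4 L 𝔾} (h : ∀ e ∈ negSideEdges S, W e = W' e)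
    {e : Edge 4 L} (he : e ∈ posLinks S) : W.negReflect e = W'.negReflect e := by
  rw [WilsonSiteRP.negReflect_apply, WilsonSiteRP.negReflect_apply, h _ (siteEdgeReflect_mem_negSide hL hS he)]

end Depends

/-! ## Dependence of the placed observable on the positive links -/

section ObsDepends

variable {R : ℕ} (A : QCDLatticeObservable Nf R) {S : ℕ} (hL : L = 2 * S + 1) (hS : 1 ≤ S)

include hL in
/-- **A positive-time observable ending by `S`, placed on the torus, depends on the positive links
only.** [cite: MontvayMunster1994, §4.2.3 (4.90)] -/
theorem onTorus_congr (hA : A.IsPositiveTime) (hE : A.LinksEndBy S) {U U' : GaugeConfig 4 L 𝔾}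
    (h : ∀ e ∈ posLinks S, U e = U' e) : A.onTorus L 0 U = A.onTorus L 0 U' := by
  unfold QCDLatticeObservable.onTorus
  congr 1
  refine A.isCylinder (fun e he => ?_)
  rw [Finset.mem_coe] at he
  simp only [QuantumLattice.configShift_apply, neg_zero, sub_zero, torusLift, Function.comp_apply, torusEdge]
  refine h _ ?_
  have h1 := hA.1 e he
  have h2 := hE e he
  have h0 : (0 : ℤ) ≤ e.1 0 := by omega
  have hle : e.1 0 + (if e.2 = 0 then 1 else 0) ≤ S := h2
  have hval : ((((Torus.proj L e.1) 0).val : ℕ) : ℤ) = e.1 0 := by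
    simp only [Torus.proj]
    rw [ZMod.val_intCast, Int.emod_eq_of_lt h0 (by split_ifs at hle <;> omega)]
  simp only [mem_posLinks]
  by_cases hi : e.2 = 0
  · rw [if_pos hi] at hle
    left; exact ⟨hi, by omega⟩
  · rw [if_neg hi] at hle
    right; exact ⟨hi, by omega, by omega⟩

end ObsDepends

/-! ## The pieces under the link split and the site reflection -/

section Split

variable {R : ℕ} (A : QCDLatticeObservable Nf R) {S : ℕ} (hL : L = 2 * S + 1) (hS : 1 ≤ S)
  (hA : A.IsPositiveTime) (hE : A.LinksEndBy S) (mq : Fin Nf → ℝ) (U Y : GaugeConfig 4 L 𝔾)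
include hL hS

omit hL hS in
/-- Negative-side links are not layer links. [folklore] -/
theorem not_layer_of_mem_negSide {e : Edge 4 L} (he : e ∈ negSideEdges S) : ¬ (e.2 = 0 ∧ (e.1 0).val = S) := by
  simp only [negSideEdges, Finset.mem_filter, Finset.mem_univ, true_and] at he
  rintro ⟨-, h⟩; omega

omit hS in
include hA hE in
/-- `𝐀` depends on the positive links only. [folklore] -/
theorem rotObs_congr {U U' : GaugeConfig 4 L 𝔾} (h : ∀ e ∈ posLinks S, U e = U' e) : rotObs A U = rotObs A U' := by
  rw [rotObs, rotObs, onTorus_congr A hL hA hE h]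

omit hS in
include hA hE in
/-- `𝐀(translateLayer S Y U) = 𝐀(U)`. [folklore] -/
theorem rotObs_translateLayer : rotObs A (translateLayer S Y U) = rotObs A U :=
  rotObs_congr A hL hA hE fun _ he => translateLayer_apply_of_not_layer Y U (not_layer_of_mem_posLinks he)

include hA hE in
/-- `𝐀(Θ'(translateLayer S Y U)) = 𝐀(Θ'U)`. [folklore] -/
theorem rotObs_negReflect_translateLayer : rotObs A (translateLayer S Y U).negReflect = rotObs A U.negReflect :=
  rotObs_congr A hL hA hE fun _ he => negReflect_apply_eq_of_mem_posLinks hL hS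
    (fun _ he' => translateLayer_apply_of_not_layer Y U (not_layer_of_mem_negSide he')) he

include hA hE in
/-- `𝐀(Θ'(splice_{layer}(U, Y))) = 𝐀(Θ'U)`. [folklore] -/
theorem rotObs_negReflect_splice :
    rotObs A (GaugeConfig.negReflect (LatticeRP.splice (layerEdges S) (U, Y))) = rotObs A U.negReflect :=
  rotObs_congr A hL hA hE fun _ he => negReflect_apply_eq_of_mem_posLinks hL hS
    (fun _ he' => splice_apply_of_not_layer U Y (not_layer_of_mem_negSide he')) he

/-- `Q₊(translateLayer S Y U) = Q₊(U)`. [folklore] -/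
theorem posPart_translateLayer : posPart (translateLayer S Y U) mq = posPart U mq :=
  posPart_congr hL hS mq fun _ he => translateLayer_apply_of_not_layer Y U (not_layer_of_mem_posLinks he)

/-- `Q₊(Θ'(translateLayer S Y U)) = Q₊(Θ'U)`. [folklore] -/
theorem posPart_negReflect_translateLayer : posPart (translateLayer S Y U).negReflect mq = posPart U.negReflect mq :=
  posPart_congr hL hS mq fun _ he => negReflect_apply_eq_of_mem_posLinks hL hS
    (fun _ he' => translateLayer_apply_of_not_layer Y U (not_layer_of_mem_negSide he')) he

/-- `Q₊(Θ'(splice_{layer}(U, Y))) = Q₊(Θ'U)`. [folklore] -/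
theorem posPart_negReflect_splice :
    posPart (GaugeConfig.negReflect (LatticeRP.splice (layerEdges S) (U, Y))) mq = posPart U.negReflect mq :=
  posPart_congr hL hS mq fun _ he => negReflect_apply_eq_of_mem_posLinks hL hS
    (fun _ he' => splice_apply_of_not_layer U Y (not_layer_of_mem_negSide he')) he

omit hS in
/-- `Q₋(V) = Θ'(Q₊(Θ'V))`. [cite: MontvayMunster1994, §4.2.3 (4.106)] -/
theorem negPart_eq_map (V : GaugeConfig 4 L 𝔾) : negPart V mq = fermiThetaRot (posPart V.negReflect mq) := by
  rw [fermiThetaRot_posPart ⟨S, hL⟩, WilsonSiteRP.negReflect_negReflect_config]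

/-- `Q₀(translateLayer S Y U) = Q₀(U)`. [folklore] -/
theorem zeroPart_translateLayer : zeroPart (translateLayer S Y U) mq = zeroPart U mq :=
  zeroPart_congr hL hS mq fun _ he => translateLayer_apply_of_not_layer Y U (not_layer_of_mem_sliceZeroEdges he)

/-- `Q^{uu}(splice_{layer}(U, Y)) = Q^{uu}(U)`. [folklore] -/
theorem uuPart_splice : uuPart (LatticeRP.splice (layerEdges S) (U, Y)) mq = uuPart U mq :=
  uuPart_congr hL hS mq fun _ he => splice_apply_of_not_layer U Y (not_layer_of_mem_sliceZeroEdges he)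

end Split

/-! ## Exponentials of the blocks -/

section Exp

variable (U : GaugeConfig 4 L 𝔾) (mq : Fin Nf → ℝ)

/-- Quadratic forms are even. [folklore] -/
theorem even_of_eq_quadratic {x : FermiAlg Nf L} {M : Matrix (FermiIdx Nf L) (FermiIdx Nf L) ℂ} (h : x = quadratic ℂ M) :
    x ∈ evenOdd ℂ (ι := FermiIdx Nf L ⊕ₗ FermiIdx Nf L) 0 := h ▸ quadratic_mem_evenOdd_zero ℂ M

/-- Quadratic forms are nilpotent. [folklore] -/
theorem isNilpotent_of_eq_quadratic {x : FermiAlg Nf L} {M : Matrix (FermiIdx Nf L) (FermiIdx Nf L) ℂ} (h : x = quadratic ℂ M) :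
    IsNilpotent x := h ▸ isNilpotent_quadratic ℂ M

/-- **`e^{ψ̄Mψ} = e^{Q₊} e^{Q₋} e^{Q₀} e^{Q_c}`** (commuting even nilpotents). [folklore] -/
theorem grassmannExp_quadratic_rotDirac :
    grassmannExp (quadratic ℂ (rotDirac U mq)) =
      grassmannExp (posPart U mq) * grassmannExp (negPart U mq) * grassmannExp (zeroPart U mq) * grassmannExp (crossPart U mq) := by
  have hP := even_of_eq_quadratic (rfl : posPart U mq = _)
  have hN := even_of_eq_quadratic (rfl : negPart U mq = _)
  have hZ := even_of_eq_quadratic (rfl : zeroPart U mq = _)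
  have hPn := isNilpotent_of_eq_quadratic (rfl : posPart U mq = _)
  have hNn := isNilpotent_of_eq_quadratic (rfl : negPart U mq = _)
  have hZn := isNilpotent_of_eq_quadratic (rfl : zeroPart U mq = _)
  have hCn := isNilpotent_of_eq_quadratic (rfl : crossPart U mq = _)
  have hPN : IsNilpotent (posPart U mq + negPart U mq) := Commute.isNilpotent_add (commute_of_mem_evenOdd_zero ℂ hP _) hPn hNn
  have hPNZ : IsNilpotent (posPart U mq + negPart U mq + zeroPart U mq) :=
    Commute.isNilpotent_add (commute_of_mem_evenOdd_zero ℂ (Submodule.add_mem _ hP hN) _) hPN hZn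
  rw [quadratic_rotDirac_split, grassmannExp_add (commute_of_mem_evenOdd_zero ℂ (Submodule.add_mem _ (Submodule.add_mem _ hP hN) hZ) _)
    hPNZ hCn, grassmannExp_add (commute_of_mem_evenOdd_zero ℂ (Submodule.add_mem _ hP hN) _) hPN hZn,
    grassmannExp_add (commute_of_mem_evenOdd_zero ℂ hP _) hPn hNn]

variable {S : ℕ} (hL : L = 2 * S + 1) (hS : 1 ≤ S)
include hL hS

/-- **`e^{Q₀} = e^{Q^{lu}} e^{Q^{uu}} Θ'(e^{Q^{uu}})`.** [cite: MontvayMunster1994, §4.2.3 (4.104)–(4.106)] -/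
theorem grassmannExp_zeroPart :
    grassmannExp (zeroPart U mq) = grassmannExp (luPart U mq) * grassmannExp (uuPart U mq) * fermiThetaRot (grassmannExp (uuPart U mq)) := by
  have hl := even_of_eq_quadratic (rfl : luPart U mq = _)
  have hu := even_of_eq_quadratic (rfl : uuPart U mq = _)
  have hln := isNilpotent_of_eq_quadratic (rfl : luPart U mq = _)
  have hun := isNilpotent_of_eq_quadratic (rfl : uuPart U mq = _)
  have hlln := isNilpotent_of_eq_quadratic (rfl : llPart U mq = _)
  rw [zeroPart_eq_add, grassmannExp_add (commute_of_mem_evenOdd_zero ℂ (Submodule.add_mem _ hl hu) _)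
    (Commute.isNilpotent_add (commute_of_mem_evenOdd_zero ℂ hl _) hln hun) hlln,
    grassmannExp_add (commute_of_mem_evenOdd_zero ℂ hl _) hln hun, llPart_eq_map_uuPart hL hS,
    ← Reflection.map_grassmannExp _ hun]

end Exp

/-! ## The crossing factor as an increasing product -/

section ConeForm

variable {S : ℕ} (hL : L = 2 * S + 1) (hS : 1 ≤ S) (mq : Fin Nf → ℝ) (U Y : GaugeConfig 4 L 𝔾)

omit [NeZero L] in
/-- A product of two degree-one elements, squared, vanishes. [folklore] -/
theorem ι_mul_ι_mul_ι_mul_ι_eq_zero {κ : Type*} (v w : κ → ℂ) :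
    ExteriorAlgebra.ι ℂ v * ExteriorAlgebra.ι ℂ w * (ExteriorAlgebra.ι ℂ v * ExteriorAlgebra.ι ℂ w) = 0 := by
  have h : ExteriorAlgebra.ι ℂ w * ExteriorAlgebra.ι ℂ v = -(ExteriorAlgebra.ι ℂ v * ExteriorAlgebra.ι ℂ w) :=
    eq_neg_of_add_eq_zero_left (ExteriorAlgebra.ι_add_mul_swap w v)
  rw [show ExteriorAlgebra.ι ℂ v * ExteriorAlgebra.ι ℂ w * (ExteriorAlgebra.ι ℂ v * ExteriorAlgebra.ι ℂ w) =
      ExteriorAlgebra.ι ℂ v * (ExteriorAlgebra.ι ℂ w * ExteriorAlgebra.ι ℂ v) * ExteriorAlgebra.ι ℂ w by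
    simp only [mul_assoc], h, mul_neg, neg_mul, ← mul_assoc (ExteriorAlgebra.ι ℂ v) (ExteriorAlgebra.ι ℂ v),
    ExteriorAlgebra.ι_sq_zero, zero_mul, zero_mul, neg_zero]

omit [NeZero L] in
/-- A product of two degree-one elements is even. [folklore] -/
theorem ι_mul_ι_even {κ : Type*} (v w : κ → ℂ) :
    ExteriorAlgebra.ι ℂ v * ExteriorAlgebra.ι ℂ w ∈ evenOdd ℂ (ι := κ) 0 :=
  CliffordAlgebra.ι_mul_ι_mem_evenOdd_zero _ v w

include hL hS in
/-- **The crossing Boltzmann factor is an increasing product of cone factors**: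
`e^{Q_c(translateLayer S Y U)} = ∏_{w ∈ layer}↑ (1 + 2 ξ_w(Θ'U) Θ'ξ_w(z))`. [cite: MontvayMunster1994, §4.2.3 (4.96)] -/
theorem grassmannExp_crossPart_translateLayer :
    grassmannExp (crossPart (translateLayer S Y U) mq) =
      ordProd (layerGens S) (fun w => 1 + (2 : ℂ) • (xiVar w U.negReflect *
        fermiThetaRot (xiVar w (LatticeRP.splice (layerEdges S) (U, Y))))) := by
  rw [crossPart_translateLayer hL hS U Y mq]
  refine grassmannExp_sum_eq_ordProd _ (fun w => ?_) (fun w w' => ?_) _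
  · obtain ⟨v, hv⟩ := xiVar_eq_ι w U.negReflect
    obtain ⟨v', hv'⟩ := xiVar_eq_ι w (LatticeRP.splice (layerEdges S) (U, Y))
    obtain ⟨v'', hv''⟩ := (fermiThetaRot (Nf := Nf) (L := L)).exists_map_ι v'
    rw [hv, hv', hv'', smul_mul_smul_comm, ι_mul_ι_mul_ι_mul_ι_eq_zero, smul_zero]
  · obtain ⟨v, hv⟩ := xiVar_eq_ι w U.negReflect
    obtain ⟨v', hv'⟩ := xiVar_eq_ι w (LatticeRP.splice (layerEdges S) (U, Y))
    obtain ⟨v'', hv''⟩ := (fermiThetaRot (Nf := Nf) (L := L)).exists_map_ι v'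
    rw [hv, hv', hv'']
    exact (commute_of_mem_evenOdd_zero ℂ (Submodule.smul_mem _ _ (ι_mul_ι_even v v'')) _)

end ConeForm

/-! ## The integrand under the link split -/

section Main

variable {R : ℕ} (A : QCDLatticeObservable Nf R) {S : ℕ} (hL : L = 2 * S + 1) (hS : 1 ≤ S)
  (hA : A.IsPositiveTime) (hE : A.LinksEndBy S) (mq : Fin Nf → ℝ) (U Y : GaugeConfig 4 L 𝔾)

omit [NeZero L] in
/-- Rearranging a product with five central factors. [folklore] -/
theorem central_rearrange {Λ' : Type*} [Semiring Λ'] (a b P c₁ c₂ c₃ c₄ c₅ : Λ')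
    (h₁ : ∀ y, Commute c₁ y) (h₂ : ∀ y, Commute c₂ y) (h₃ : ∀ y, Commute c₃ y) (h₄ : ∀ y, Commute c₄ y)
    (h₅ : ∀ y, Commute c₅ y) :
    a * b * (c₁ * c₂ * (c₃ * c₄ * c₅) * P) = a * c₁ * c₄ * (c₅ * (c₂ * b)) * P * c₃ := by
  simp only [mul_assoc]
  rw [← (h₃ P).eq, (h₂ b).left_comm, (h₅ b).left_comm, (h₄ b).left_comm, (h₁ b).left_comm, (h₅ c₂).left_comm,
    (h₄ c₂).left_comm, (h₅ c₃).left_comm, (h₄ c₃).left_comm]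

include hL hS hA hE in
/-- **The OS integrand of lattice QCD under the Osterwalder–Seiler link split** (Montvay–Münster
(4.104)–(4.107) on the odd torus): for `V = translateLayer S Y U`, `z = splice_{layer}(U, Y)`,
`𝐀(V) · Θ'(𝐀(Θ'V)) · e^{ψ̄M(V)ψ} = G · Θ'H · ∏_{w ∈ layer}↑(1 + 2 ξ_w(Θ'U) Θ'ξ_w(z)) · e^{Q^{lu}(U)}` with
`G = 𝐀(U) e^{Q₊(U)} e^{Q^{uu}(U)}`, `H = 𝐀(Θ'U) e^{Q₊(Θ'U)} e^{Q^{uu}(U)}`. [cite: MontvayMunster1994, §4.2.3 (4.104)–(4.107)] -/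
theorem osIntegrand_translateLayer :
    rotObs A (translateLayer S Y U) * fermiThetaRot (rotObs A (translateLayer S Y U).negReflect) *
        grassmannExp (quadratic ℂ (rotDirac (translateLayer S Y U) mq)) =
      (rotObs A U * grassmannExp (posPart U mq) * grassmannExp (uuPart U mq)) *
        fermiThetaRot (rotObs A U.negReflect * grassmannExp (posPart U.negReflect mq) * grassmannExp (uuPart U mq)) *
        ordProd (layerGens S) (fun w => 1 + (2 : ℂ) • (xiVar w U.negReflect *
          fermiThetaRot (xiVar w (LatticeRP.splice (layerEdges S) (U, Y))))) *
        grassmannExp (luPart U mq) := by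
  have hPe := grassmannExp_even (even_of_eq_quadratic (rfl : posPart U mq = _))
    (isNilpotent_of_eq_quadratic (rfl : posPart U mq = _))
  have hP'n := isNilpotent_of_eq_quadratic (rfl : posPart U.negReflect mq = _)
  have hP'e := grassmannExp_even (even_of_eq_quadratic (rfl : posPart U.negReflect mq = _)) hP'n
  have hle := grassmannExp_even (even_of_eq_quadratic (rfl : luPart U mq = _))
    (isNilpotent_of_eq_quadratic (rfl : luPart U mq = _))
  have hun := isNilpotent_of_eq_quadratic (rfl : uuPart U mq = _)
  have hue := grassmannExp_even (even_of_eq_quadratic (rfl : uuPart U mq = _)) hun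
  -- evenness is preserved by `Θ'`
  have hNe : fermiThetaRot (grassmannExp (posPart U.negReflect mq)) ∈ evenOdd ℂ (ι := FermiIdx Nf L ⊕ₗ FermiIdx Nf L) 0 := by
    rw [Reflection.map_grassmannExp _ hP'n, ← negPart_eq_map hL mq U]
    exact grassmannExp_even (even_of_eq_quadratic rfl) (isNilpotent_of_eq_quadratic rfl)
  have hlle : fermiThetaRot (grassmannExp (uuPart U mq)) ∈ evenOdd ℂ (ι := FermiIdx Nf L ⊕ₗ FermiIdx Nf L) 0 := by
    rw [Reflection.map_grassmannExp _ hun, ← llPart_eq_map_uuPart hL hS]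
    exact grassmannExp_even (even_of_eq_quadratic rfl) (isNilpotent_of_eq_quadratic rfl)
  rw [rotObs_translateLayer A hL hA hE, rotObs_negReflect_translateLayer A hL hS hA hE, grassmannExp_quadratic_rotDirac,
    posPart_translateLayer hL hS, negPart_eq_map hL, posPart_negReflect_translateLayer hL hS,
    ← Reflection.map_grassmannExp _ hP'n, zeroPart_translateLayer hL hS, grassmannExp_zeroPart U mq hL hS,
    grassmannExp_crossPart_translateLayer hL hS mq U Y, (fermiThetaRot (Nf := Nf) (L := L)).map_mul,
    (fermiThetaRot (Nf := Nf) (L := L)).map_mul]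
  exact central_rearrange _ _ _ _ _ _ _ _ (commute_of_mem_evenOdd_zero ℂ hPe) (commute_of_mem_evenOdd_zero ℂ hNe)
    (commute_of_mem_evenOdd_zero ℂ hle) (commute_of_mem_evenOdd_zero ℂ hue) (commute_of_mem_evenOdd_zero ℂ hlle)

end Main

end

end Literature.MathematicalPhysics.QuantumFieldTheory

/-!
## Part: The fermionic covariance identity of lattice QCD site-reflection positivity

Companion of Part Integrand (above) (the OS integrand of `⟨A · ΘA⟩_AP` under the Osterwalder–Seiler
link split, in the `γ₀`-diagonal frame), `GrassmannReflectionPositivity` (the cone expansion),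
`GrassmannSiteReflectionPairing` (the reduction of the Berezin integral to the reflection slice and
the Gaussian slice pairing) and `QCDSiteRPSliceVars` (the slice substitution `φ`, the top pairing
constant, the positive slice coupling `K = sliceK`).  For a positive-time observable `A` on the odd
torus `L = 2S+1` and `V = translateLayer S Y U`, `z = splice_{layer}(U, Y)`:

* `gObs`, `gObsT`, `gCoef` — `𝒢(W) = 𝐀(Θ'W) e^{Q₊(Θ'W)} e^{Q^{uu}(W)}`, `𝒢_t(W) = 𝒢(W) ∏_{w∈t}↑ ξ_w(W)`,
  `g_{t,J}(W) = [θ_{emb J}] ∫dθ_P 𝒢_t(W)` (the coefficient functions of the positivity mechanism);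
* **`berezin_osIntegrand_translateLayer`** (Montvay–Münster (4.96), (4.107)–(4.110) assembled):
  `∫ 𝐀(V) Θ'(𝐀(Θ'V)) e^{ψ̄M(V)ψ} = c_N C ε det(−K(U)) Σ_{t ⊆ layer} 2^{|t|} Σ_{I,J} g_{t,I}(Θ'U) conj g_{t,J}(z) Γ(K(U)⁻¹)_{IJ}`
  with `c_N ≠ 0` (`Θ'θ_P = c_N θ_N`), `C = topConst ≠ 0`, `ε = (−1)^{n(n−1)/2}`, `Γ` the compound-matrix
  kernel of `GrassmannGaussianPairing` — positive semidefinite since `K(U) ≻ 0`.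

Everything is proved; no named fact. [cite: MontvayMunster1994, §4.2.3 (4.96) and (4.107)–(4.110)]
-/

namespace Literature.MathematicalPhysics.QuantumFieldTheory

open Literature.Probability Literature.Probability.LatticeModels
open Literature.MathematicalPhysics.QuantumLattice
open Literature.MathematicalPhysics.QuantumLattice.GrassmannAlgebra
open WilsonNegRP SliceIdx
open scoped ComplexConjugate Matrix

noncomputable section

local notation "𝔾" => Matrix.specialUnitaryGroup (Fin 3) ℂ

variable {Nf L : ℕ} [NeZero L]

/-! ## The coefficient functions -/

section Coef

variable {R : ℕ} (A : QCDLatticeObservable Nf R) (mq : Fin Nf → ℝ)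

/-- **`𝒢(W) = 𝐀(Θ'W) e^{Q₊(Θ'W)} e^{Q^{uu}(W)}`** — the positive-time factor as a function of the
configuration `W` through its NEGATIVE-side links (and the slice). [cite: MontvayMunster1994, §4.2.3 (4.107)] -/
def gObs (W : GaugeConfig 4 L 𝔾) : FermiAlg Nf L :=
  rotObs A W.negReflect * grassmannExp (posPart W.negReflect mq) * grassmannExp (uuPart W mq)

/-- **`𝒢_t(W) = 𝒢(W) ∏_{w ∈ t}↑ ξ_w(W)`** — with the crossing variables of the cone term `t`. [folklore] -/
def gObsT (t : Finset (FermiIdx Nf L ⊕ₗ FermiIdx Nf L)) (W : GaugeConfig 4 L 𝔾) : FermiAlg Nf L :=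
  gObs A mq W * ordProd t (fun w => xiVar w W)

/-- **The coefficient functions `g_{t,J}(W) = [θ_{emb J}] ∫dθ_P 𝒢_t(W)`.** [folklore] -/
def gCoef (t : Finset (FermiIdx Nf L ⊕ₗ FermiIdx Nf L)) (J : Finset (SliceIdx Nf L)) (W : GaugeConfig 4 L 𝔾) : ℂ :=
  (grassmannBasis ℂ (FermiIdx Nf L ⊕ₗ FermiIdx Nf L)).repr (berezinOn ℂ (posGens Nf L) (gObsT A mq t W)) (J.image emb)

variable {S : ℕ} (hL : L = 2 * S + 1) (hS : 1 ≤ S) (hA : A.IsPositiveTime) (hE : A.LinksEndBy S)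
  (U Y : GaugeConfig 4 L 𝔾)
include hL hS

/-- The `G`-side of the integrand is `𝒢(Θ'U)`. [folklore] -/
theorem gSide_eq : rotObs A U * grassmannExp (posPart U mq) * grassmannExp (uuPart U mq) = gObs A mq U.negReflect := by
  rw [gObs, WilsonSiteRP.negReflect_negReflect_config, uuPart_negReflect hL hS]

include hA hE in
/-- The `H`-side of the integrand is `𝒢(z)`. [folklore] -/
theorem hSide_eq : rotObs A U.negReflect * grassmannExp (posPart U.negReflect mq) * grassmannExp (uuPart U mq) =
    gObs A mq (LatticeRP.splice (layerEdges S) (U, Y)) := by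
  rw [gObs, rotObs_negReflect_splice A hL hS hA hE, posPart_negReflect_splice hL hS, uuPart_splice hL hS]

end Coef

/-! ## Supports -/

section Support

variable {R : ℕ} (A : QCDLatticeObservable Nf R) (mq : Fin Nf → ℝ) {S : ℕ} (hL : L = 2 * S + 1) (hS : 1 ≤ S)
  (hRL : 2 * R < L) (hA : A.IsPositiveTime)

/-- `N ∪ L₀ ⊆ N ∪ Z`. [folklore] -/
theorem negGens_union_lowerGens_subset : negGens Nf L ∪ lowerGens Nf L ⊆ negGens Nf L ∪ zeroGens Nf L := by
  intro w hw
  rw [Finset.mem_union] at hw ⊢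
  rcases hw with hw | hw
  · exact Or.inl hw
  · exact Or.inr (by rw [zeroGens_eq_upper_union_lower, Finset.mem_union]; exact Or.inr hw)

/-- `N ⊆ N ∪ L₀`. [folklore] -/
theorem negGens_subset_union : negGens Nf L ⊆ negGens Nf L ∪ lowerGens Nf L := Finset.subset_union_left

/-- `(N ∪ L₀) ∪ P = U₀ᶜ`. [folklore] -/
theorem negGens_union_lowerGens_union_posGens :
    negGens Nf L ∪ lowerGens Nf L ∪ posGens Nf L = (upperGens Nf L)ᶜ := by
  ext w
  have hz := mem_zeroGens_iff_not_mem (Nf := Nf) (L := L) w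
  rw [zeroGens_eq_upper_union_lower] at hz
  simp only [Finset.mem_union, Finset.mem_compl] at hz ⊢
  have hd : w ∈ upperGens Nf L → w ∉ lowerGens Nf L := fun h1 h2 =>
    Finset.disjoint_left.1 (disjoint_upperGens_lowerGens (Nf := Nf) (L := L)) h1 h2
  tauto

include hL hS hRL hA in
/-- **`𝒢_t(W)` is a spectator of `N ∪ L₀`** for `t ⊆ layerGens S`. [folklore] -/
theorem gObsT_mem {t : Finset (FermiIdx Nf L ⊕ₗ FermiIdx Nf L)} (ht : t ⊆ layerGens S) (W : GaugeConfig 4 L 𝔾) :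
    gObsT A mq t W ∈ spectatorSubalgebra ℂ (negGens Nf L ∪ lowerGens Nf L) := by
  have hmono := spectatorSubalgebra_mono ℂ (negGens_union_lowerGens_subset (Nf := Nf) (L := L))
  unfold gObsT gObs rotObs
  refine Subalgebra.mul_mem _ (Subalgebra.mul_mem _ (Subalgebra.mul_mem _ ?_ ?_) ?_) ?_
  · exact hmono (spinUnrot_onTorus_mem hRL A hA _)
  · exact grassmannExp_mem (posPart_mem _ mq hL hS)
  · exact grassmannExp_mem (uuPart_mem _ mq)
  · rw [ordProd]
    refine Subalgebra.list_prod_mem _ fun x hx => ?_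
    obtain ⟨w, hw, rfl⟩ := List.mem_map.1 hx
    exact hmono (xiVar_mem_spectator hS (by omega) (ht ((Finset.mem_sort _).1 hw)) W)

include hL hS hRL hA in
/-- `∫dθ_P 𝒢_t(W)` is supported on the upper slice generators. [folklore] -/
theorem berezinOn_gObsT_mem {t : Finset (FermiIdx Nf L ⊕ₗ FermiIdx Nf L)} (ht : t ⊆ layerGens S) (W : GaugeConfig 4 L 𝔾) :
    berezinOn ℂ (posGens Nf L) (gObsT A mq t W) ∈ spectatorSubalgebra ℂ (upperGens Nf L)ᶜ := by
  have h := berezinOn_mem_spectatorSubalgebra ℂ (s := posGens Nf L) (gObsT_mem A mq hL hS hRL hA ht W)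
  exact spectatorSubalgebra_mono ℂ (Finset.subset_of_eq negGens_union_lowerGens_union_posGens.symm) h

include hL hS hRL hA in
/-- **`∫dθ_P 𝒢_t(W) = Σ_J g_{t,J}(W) φ(ψ_J)`.** [folklore] -/
theorem berezinOn_gObsT_eq_sum {t : Finset (FermiIdx Nf L ⊕ₗ FermiIdx Nf L)} (ht : t ⊆ layerGens S) (W : GaugeConfig 4 L 𝔾) :
    berezinOn ℂ (posGens Nf L) (gObsT A mq t W) =
      ∑ J : Finset (SliceIdx Nf L), gCoef A mq t J W • ExteriorAlgebra.map slicePhi (psiProd (SliceIdx Nf L) J) :=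
  eq_sum_coord_smul_map_psiProd (berezinOn_gObsT_mem A mq hL hS hRL hA ht W)

end Support

/-! ## The covariance identity -/

section Covariance

variable {R : ℕ} (A : QCDLatticeObservable Nf R) (mq : Fin Nf → ℝ) {S : ℕ} (hL : L = 2 * S + 1) (hS : 1 ≤ S)
  (hRL : 2 * R < L) (hA : A.IsPositiveTime) (hE : A.LinksEndBy S) (hm : ∀ f, -1 < mq f) (U Y : GaugeConfig 4 L 𝔾)

/-- `e^{Q^{lu}(U)} = φ(e^{ψ̄(−K(U))ψ})`. [cite: MontvayMunster1994, §4.2.3 (4.109)] -/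
theorem grassmannExp_luPart_eq_map (hL1 : 1 < L) :
    grassmannExp (luPart U mq) = ExteriorAlgebra.map slicePhi (grassmannExp (quadratic ℂ (-sliceK U mq))) := by
  rw [luPart_eq_map_slicePhi U mq hL1, grassmannExp, grassmannExp,
    IsNilpotent.map_exp (isNilpotent_quadratic ℂ _) (ExteriorAlgebra.map slicePhi)]

include hL hS hRL hA hE hm in
/-- **The fermionic covariance identity** (Montvay–Münster §4.2.3 (4.96), (4.104)–(4.110) on the odd
torus, after the Osterwalder–Seiler link split): with `V = translateLayer S Y U`, `z = splice_{layer}(U,Y)`,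
`∫ 𝐀(V)·Θ'(𝐀(Θ'V))·e^{ψ̄M(V)ψ} = c_N · C · (ε · det(−K(U))) · Σ_{t ⊆ layer} 2^{|t|} Σ_{I,J} g_{t,I}(Θ'U) conj g_{t,J}(z) Γ(K(U)⁻¹)_{IJ}`. [cite: MontvayMunster1994, §4.2.3 (4.96) and (4.107)–(4.110)] -/
theorem berezin_osIntegrand_translateLayer {cN : ℂ}
    (hcN : fermiThetaRot (grassmannBasis ℂ _ (posGens Nf L)) = cN • grassmannBasis ℂ _ (negGens Nf L)) :
    fermiIntegral (rotObs A (translateLayer S Y U) * fermiThetaRot (rotObs A (translateLayer S Y U).negReflect) *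
        grassmannExp (quadratic ℂ (rotDirac (translateLayer S Y U) mq))) =
      cN * topConst Nf L * ((-1 : ℂ) ^ (Fintype.card (SliceIdx Nf L) * (Fintype.card (SliceIdx Nf L) - 1) / 2) *
        (-sliceK U mq).det) *
        ∑ t ∈ (layerGens S).powerset, (2 : ℂ) ^ t.card *
          ∑ I : Finset (SliceIdx Nf L), ∑ J : Finset (SliceIdx Nf L),
            gCoef A mq t I U.negReflect * conj (gCoef A mq t J (LatticeRP.splice (layerEdges S) (U, Y))) *
              Gamma (sliceK U mq)⁻¹ I J := by
  have hodd : Odd L := ⟨S, hL⟩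
  have hL1 : 1 < L := by omega
  set z := LatticeRP.splice (layerEdges S) (U, Y) with hz
  -- Step 1: the algebraic form of the integrand and the cone expansion
  rw [osIntegrand_translateLayer A hL hS hA hE mq U Y, gSide_eq A mq hL hS U, hSide_eq A mq hL hS hA hE U Y,
    mul_map_mul_ordProd_cone fermiThetaRot (fun _ => (2 : ℂ)) (fun w => xiVar_eq_ι w U.negReflect) (fun w => xiVar_eq_ι w z),
    Finset.sum_mul, map_sum, Finset.mul_sum]
  refine Finset.sum_congr rfl fun t ht => ?_
  have ht' : t ⊆ layerGens S := Finset.mem_powerset.1 ht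
  rw [Finset.prod_const, smul_mul_assoc, map_smul, smul_eq_mul]
  -- Step 2: reduction to the slice
  have hG₁ : gObs A mq U.negReflect * ordProd t (fun w => xiVar w U.negReflect) ∈ spectatorSubalgebra ℂ (negGens Nf L) :=
    spectatorSubalgebra_mono ℂ negGens_subset_union (gObsT_mem A mq hL hS hRL hA ht' U.negReflect)
  have hG₂ : gObs A mq z * ordProd t (fun w => xiVar w z) ∈ spectatorSubalgebra ℂ (negGens Nf L) :=
    spectatorSubalgebra_mono ℂ negGens_subset_union (gObsT_mem A mq hL hS hRL hA ht' z)
  rw [show (fermiIntegral : FermiAlg Nf L →ₗ[ℂ] ℂ) = berezin ℂ (FermiIdx Nf L ⊕ₗ FermiIdx Nf L) from rfl,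
    berezin_mul_map_mul_eq_top fermiThetaRot fermiThetaRot_gen reflGen_injective (image_reflGen_posGens hodd)
      disjoint_posGens_negGens (fun w hw => reflGen_not_mem_union hw) hcN hG₁ hG₂
      (grassmannExp_mem (luPart_mem U mq))]
  -- Step 3: the slice Gaussian pairing
  rw [show gObs A mq U.negReflect * ordProd t (fun w => xiVar w U.negReflect) = gObsT A mq t U.negReflect from rfl,
    show gObs A mq z * ordProd t (fun w => xiVar w z) = gObsT A mq t z from rfl,
    berezinOn_gObsT_eq_sum A mq hL hS hRL hA ht', berezinOn_gObsT_eq_sum A mq hL hS hRL hA ht',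
    grassmannExp_luPart_eq_map mq U hL1, ← topLam_apply, ← mul_assoc,
    map_pairing_gaussian_eq fermiThetaRot slicePhi fermiThetaRot_map_slicePhi_psi topLam topLam_map_slicePhi
      (-sliceK U mq) (isUnit_det_neg_sliceK U mq hm), neg_inv_neg_sliceK U mq hm]
  ring

end Covariance

end

end Literature.MathematicalPhysics.QuantumFieldTheory

/-!
## Part: Site-reflection positivity of lattice QCD with Wilson quarks — the proof

Discharge of the named fact `WilsonQCDSiteReflectionPositivityAP` of `QCDTimeReflection`
(Montvay–Münster 1994 §4.2.3, Lüscher 1977, Osterwalder–Seiler 1978): for `β ≥ 0`, `m_f > −1`,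
`S ≥ 1` and a positive-time gauge-invariant local observable `A` ending by time `S`, on the torus of
odd side `L = 2S + 1` with time-antiperiodic quarks, `⟨A · ΘA⟩_AP ≥ 0` (real and non-negative).

The `im = 0` half is `WilsonQCDSiteReflectionPositivityAP_im` (`QCDTimeReflectionProofs`).  The
positivity half assembles: the frame form and the link-split form of the integrand
(Part Integrand (above)), the fermionic covariance identity (Part Covariance (above):
`∫dψ̄dψ = c · det(−K) Σ_t 2^{|t|} Σ g conj g Γ(K⁻¹)`), the regularity of its coefficient functions
(this file: continuity in the gauge field of all matrix entries, compactness bounds, the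
coefficientwise calculus of `GrassmannCoefficientRegularity`), and the gauge-field positivity theorem
with a positive semidefinite slice kernel (`wilsonExpectation_nonneg_of_negCovariantKernel`), applied
to `Φ = c̄₀ … = c₀ · conj F`; the quotient `N/D` is then a quotient of two non-negative reals.

Everything is proved; no named fact. [cite: MontvayMunster1994, §4.2.3 (4.90)–(4.110)] [cite: OsterwalderSeiler1978, §2–§3]
-/

namespace Literature.MathematicalPhysics.QuantumFieldTheory

open _root_.MeasureTheory
open Literature.Probability Literature.Probability.LatticeModels
open Literature.MathematicalPhysics.QuantumLattice
open Literature.MathematicalPhysics.QuantumLattice.GrassmannAlgebra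
open WilsonNegRP SliceIdx
open scoped ComplexConjugate ComplexOrder Matrix

noncomputable section

local notation "𝔾" => Matrix.specialUnitaryGroup (Fin 3) ℂ

variable {Nf L : ℕ} [NeZero L]

/-! ## Continuity of the matrix entries in the gauge field; compactness bounds -/

section Continuity

/-- A continuous complex function on the (compact) configuration space is bounded. [folklore] -/
theorem exists_norm_le_of_continuous {X : Type*} [TopologicalSpace X] [CompactSpace X] [Nonempty X]
    {f : X → ℂ} (hf : Continuous f) : ∃ C : ℝ, ∀ x, ‖f x‖ ≤ C := by
  obtain ⟨x₀, -, hx₀⟩ := isCompact_univ.exists_isMaxOn Set.univ_nonempty hf.norm.continuousOn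
  exact ⟨‖f x₀‖, fun x => hx₀ (Set.mem_univ x)⟩

omit [NeZero L] in
/-- Link matrix entries are continuous in the gauge field. [folklore] -/
theorem continuous_coe_apply (e : Edge 4 L) (a b : Fin 3) :
    Continuous fun U : GaugeConfig 4 L 𝔾 => ((U e : 𝔾) : Matrix (Fin 3) (Fin 3) ℂ) a b :=
  (continuous_subtype_val.comp (continuous_apply e)).matrix_elem a b

omit [NeZero L] in
/-- Inverse link matrix entries are continuous in the gauge field. [folklore] -/
theorem continuous_coe_inv_apply (e : Edge 4 L) (a b : Fin 3) :
    Continuous fun U : GaugeConfig 4 L 𝔾 => (((U e)⁻¹ : 𝔾) : Matrix (Fin 3) (Fin 3) ℂ) a b :=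
  (continuous_subtype_val.comp ((continuous_apply e).inv)).matrix_elem a b

omit [NeZero L] in
/-- `hopF` is continuous in the gauge field. [folklore] -/
theorem continuous_hopF (μ : Fin 4) (x : TorusSite 4 L) (a : Fin 3) (y : TorusSite 4 L) (b : Fin 3) :
    Continuous fun U : GaugeConfig 4 L 𝔾 => hopF U μ x a y b := by
  unfold hopF
  split_ifs
  · exact continuous_const.mul (continuous_coe_apply _ _ _)
  · exact continuous_const

omit [NeZero L] in
/-- `hopB` is continuous in the gauge field. [folklore] -/
theorem continuous_hopB (μ : Fin 4) (x : TorusSite 4 L) (a : Fin 3) (y : TorusSite 4 L) (b : Fin 3) :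
    Continuous fun U : GaugeConfig 4 L 𝔾 => hopB U μ x a y b := by
  unfold hopB
  split_ifs
  · exact continuous_const.mul (continuous_coe_inv_apply _ _ _)
  · exact continuous_const

/-- **The entries of the rotated action matrix `M(U)` are continuous in `U`.** [folklore] -/
theorem continuous_rotDirac_apply (mq : Fin Nf → ℝ) (p q : FermiIdx Nf L) :
    Continuous fun U : GaugeConfig 4 L 𝔾 => rotDirac U mq p q := by
  obtain ⟨v, rfl⟩ := quarkEquiv.surjective p
  obtain ⟨w, rfl⟩ := quarkEquiv.surjective q
  simp only [rotDirac_apply']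
  by_cases hf : v.1 = w.1
  · simp only [hf, if_true]
    have hs : Continuous fun U : GaugeConfig 4 L 𝔾 => ∑ μ : Fin 4,
        (hopF U μ v.2.1 v.2.2.1 w.2.1 w.2.2.1 * (2 * (1 : Matrix (Fin 4) (Fin 4) ℂ) v.2.2.2 w.2.2.2 - rotGamma μ v.2.2.2 w.2.2.2) +
          hopB U μ v.2.1 v.2.2.1 w.2.1 w.2.2.1 * (2 * (1 : Matrix (Fin 4) (Fin 4) ℂ) v.2.2.2 w.2.2.2 + rotGamma μ v.2.2.2 w.2.2.2)) :=
      continuous_finsetSum _ fun μ _ =>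
        ((continuous_hopF μ _ _ _ _).mul continuous_const).add ((continuous_hopB μ _ _ _ _).mul continuous_const)
    exact continuous_const.add (continuous_const.mul hs)
  · simp only [hf, if_false]
    exact continuous_const

omit [NeZero L] in
/-- The slice hopping matrices are continuous in `U`. [folklore] -/
theorem continuous_hopT_apply (j : Fin 3) (p q : ColourSite L) :
    Continuous fun U : GaugeConfig 4 L 𝔾 => hopT U j p q := by
  simp only [hopT_apply]
  split_ifs
  · exact continuous_coe_apply _ _ _
  · exact continuous_const

/-- Montvay–Münster's `B` is continuous in `U`. [folklore] -/
theorem continuous_sliceB_apply (m : ℝ) (p q : ColourSite L) :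
    Continuous fun U : GaugeConfig 4 L 𝔾 => sliceB U m p q := by
  simp only [sliceB_apply]
  refine Continuous.sub continuous_const (Continuous.mul continuous_const ?_)
  exact continuous_finsetSum _ fun j _ => (continuous_hopT_apply j p q).add (continuous_hopT_apply j q p).star

/-- The slice coupling is continuous in `U`. [folklore] -/
theorem continuous_sliceK (mq : Fin Nf → ℝ) : Continuous fun U : GaugeConfig 4 L 𝔾 => sliceK U mq := by
  refine continuous_pi fun j => continuous_pi fun k => ?_
  simp only [sliceK_apply]
  split_ifs
  · exact continuous_const.mul (continuous_sliceB_apply _ _ _)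
  · exact continuous_const.mul (continuous_sliceB_apply _ _ _)
  · exact continuous_const

/-- **The inverse slice coupling is continuous in `U`** (`det K(U) ≠ 0` everywhere). [folklore] -/
theorem continuous_inv_sliceK (mq : Fin Nf → ℝ) (hm : ∀ f, -1 < mq f) :
    Continuous fun U : GaugeConfig 4 L 𝔾 => (sliceK U mq)⁻¹ := by
  have hdet : Continuous fun U : GaugeConfig 4 L 𝔾 => (sliceK U mq).det := (continuous_sliceK mq).matrix_det
  have hne : ∀ U : GaugeConfig 4 L 𝔾, (sliceK U mq).det ≠ 0 := fun U => (isUnit_det_sliceK U mq hm).ne_zero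
  have h : (fun U : GaugeConfig 4 L 𝔾 => (sliceK U mq)⁻¹) = fun U => ((sliceK U mq).det)⁻¹ • (sliceK U mq).adjugate := by
    funext U
    rw [Matrix.inv_def, Ring.inverse_eq_inv]
  rw [h]
  exact (hdet.inv₀ hne).smul (continuous_sliceK mq).matrix_adjugate

/-- The compound-matrix kernel of the inverse slice coupling is continuous in `U`. [folklore] -/
theorem continuous_Gamma_inv_sliceK (mq : Fin Nf → ℝ) (hm : ∀ f, -1 < mq f) (I J : Finset (SliceIdx Nf L)) :
    Continuous fun U : GaugeConfig 4 L 𝔾 => Gamma (sliceK U mq)⁻¹ I J := by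
  by_cases h : I.card = J.card
  · simp only [Gamma_apply_of_card_eq _ h rfl]
    exact ((continuous_inv_sliceK mq hm).matrix_submatrix _ _).matrix_det
  · simp only [Gamma_apply_of_card_ne _ h]
    exact continuous_const

end Continuity

/-! ## Coefficient regularity of the pieces -/

section Regularity

variable {R : ℕ} (A : QCDLatticeObservable Nf R) (mq : Fin Nf → ℝ)

/-- A continuous scalar function times a fixed element is regular. [folklore] -/
theorem coeffRegular_smul_const {ι : Type*} [LinearOrder ι] [Fintype ι] {f : GaugeConfig 4 L 𝔾 → ℂ} (hf : Continuous f)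
    (y : GrassmannAlgebra ℂ ι) : CoeffRegular (fun U => f U • y) := by
  obtain ⟨C, hC⟩ := exists_norm_le_of_continuous hf
  exact (coeffRegular_const y).smul hf.measurable hC

/-- The quadratic form of a matrix with continuous entries is regular. [folklore] -/
theorem coeffRegular_quadratic {M : GaugeConfig 4 L 𝔾 → Matrix (FermiIdx Nf L) (FermiIdx Nf L) ℂ}
    (hM : ∀ p q, Continuous fun U => M U p q) : CoeffRegular (fun U => quadratic ℂ (M U)) := by
  unfold quadratic
  exact CoeffRegular.sum _ fun p _ => CoeffRegular.sum _ fun q _ => coeffRegular_smul_const (hM p q) _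

/-- A quadratic form has no constant term. [folklore] -/
theorem coord_empty_quadratic (M : Matrix (FermiIdx Nf L) (FermiIdx Nf L) ℂ) :
    (grassmannBasis ℂ (FermiIdx Nf L ⊕ₗ FermiIdx Nf L)).coord ∅ (quadratic ℂ M) = 0 := by
  rw [← constPart_eq_coord_empty ℂ, quadratic]
  simp only [map_sum, map_smul, map_mul, psiBar, psi, constPart_gen, mul_zero, smul_zero, Finset.sum_const_zero]

/-- `e^{ψ̄(mask M(U))ψ}` is regular for any time mask. [folklore] -/
theorem coeffRegular_grassmannExp_maskT (ρ : ℕ → ℕ → Prop) [DecidableRel ρ] :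
    CoeffRegular (fun U : GaugeConfig 4 L 𝔾 => grassmannExp (quadratic ℂ (maskT ρ (rotDirac U mq)))) := by
  refine (coeffRegular_quadratic fun p q => ?_).grassmannExp fun U => coord_empty_quadratic _
  simp only [maskT_apply]
  split_ifs
  · exact continuous_rotDirac_apply mq p q
  · exact continuous_const

/-- `e^{Q^{uu}(U)}` is regular. [folklore] -/
theorem coeffRegular_grassmannExp_uuPart :
    CoeffRegular (fun U : GaugeConfig 4 L 𝔾 => grassmannExp (uuPart U mq)) := by
  unfold uuPart sliceMat
  refine (coeffRegular_quadratic fun p q => ?_).grassmannExp fun U => coord_empty_quadratic _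
  simp only [maskS_apply, maskT_apply]
  split_ifs
  · exact continuous_rotDirac_apply mq p q
  · exact continuous_const
  · exact continuous_const

/-- The boxed observable is coefficient-regular. [folklore] -/
theorem coeffRegular_boxObs : CoeffRegular (fun X : LGConfig 4 𝔾 => A.F X) :=
  coeffRegular_of_pairing (fun s => exists_berezin_mul_eq_coord ℂ s) A.measurable A.bounded

/-- **The placed, rotated observable `𝐀(U)` is coefficient-regular.** [folklore] -/
theorem coeffRegular_rotObs : CoeffRegular (fun U : GaugeConfig 4 L 𝔾 => rotObs A U) := by
  unfold rotObs QCDLatticeObservable.onTorus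
  exact (((coeffRegular_boxObs A).comp ((QuantumLattice.configShift _).measurable.comp (measurable_torusLift L))).algHom _).algHom _

/-- `𝐀(Θ'U)` is coefficient-regular. [folklore] -/
theorem coeffRegular_rotObs_negReflect : CoeffRegular (fun U : GaugeConfig 4 L 𝔾 => rotObs A U.negReflect) :=
  (coeffRegular_rotObs A).comp WilsonSiteRP.measurable_negReflect

/-- The layer variables are coefficient-regular. [folklore] -/
theorem coeffRegular_xiVar (w : FermiIdx Nf L ⊕ₗ FermiIdx Nf L) : CoeffRegular (fun W : GaugeConfig 4 L 𝔾 => xiVar w W) := by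
  rcases h : ofLex w with i | i
  · have hw : w = toLex (Sum.inl (quarkEquiv (quarkEquiv.symm i))) := by rw [Equiv.apply_symm_apply, ← h, toLex_ofLex]
    subst hw
    simp only [xiVar_inl]
    exact CoeffRegular.sum _ fun a _ => coeffRegular_smul_const (continuous_coe_inv_apply _ _ _) _
  · have hw : w = toLex (Sum.inr (quarkEquiv (quarkEquiv.symm i))) := by rw [Equiv.apply_symm_apply, ← h, toLex_ofLex]
    subst hw
    simp only [xiVar_inr]
    exact CoeffRegular.sum _ fun b _ => coeffRegular_smul_const (continuous_coe_apply _ _ _) _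

/-- **`𝒢_t(W)` is coefficient-regular.** [folklore] -/
theorem coeffRegular_gObsT (t : Finset (FermiIdx Nf L ⊕ₗ FermiIdx Nf L)) :
    CoeffRegular (fun W : GaugeConfig 4 L 𝔾 => gObsT A mq t W) := by
  unfold gObsT gObs posPart ordProd
  refine (((coeffRegular_rotObs_negReflect A).mul ?_).mul (coeffRegular_grassmannExp_uuPart mq)).mul
    (CoeffRegular.list_prod _ fun w _ => coeffRegular_xiVar w)
  exact (coeffRegular_grassmannExp_maskT mq (posR L)).comp WilsonSiteRP.measurable_negReflect

/-- **The coefficient functions `g_{t,J}` are measurable.** [folklore] -/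
theorem measurable_gCoef (t : Finset (FermiIdx Nf L ⊕ₗ FermiIdx Nf L)) (J : Finset (SliceIdx Nf L)) :
    Measurable (gCoef A mq t J : GaugeConfig 4 L 𝔾 → ℂ) :=
  (((coeffRegular_gObsT A mq t).linearMap (berezinOn ℂ (posGens Nf L))) (J.image emb)).1

/-- **The coefficient functions `g_{t,J}` are bounded.** [folklore] -/
theorem exists_bound_gCoef (t : Finset (FermiIdx Nf L ⊕ₗ FermiIdx Nf L)) (J : Finset (SliceIdx Nf L)) :
    ∃ C : ℝ, ∀ W : GaugeConfig 4 L 𝔾, ‖gCoef A mq t J W‖ ≤ C :=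
  (((coeffRegular_gObsT A mq t).linearMap (berezinOn ℂ (posGens Nf L))) (J.image emb)).2

/-- **The pairing observable `V ↦ ∫ A(V) (ΘA)(V) e^{−ψ̄D^{AP}(V)ψ}` is measurable.** [folklore] -/
theorem measurable_fermiIntegral_osPair :
    Measurable fun V : GaugeConfig 4 L 𝔾 =>
      fermiIntegral (A.onTorus L 0 V * A.osAdjoint.onTorus L 0 V * fermiBoltzmannAP V mq) := by
  have h : CoeffRegular fun V : GaugeConfig 4 L 𝔾 =>
      rotObs A V * fermiThetaRot (rotObs A V.negReflect) * grassmannExp (quadratic ℂ (rotDirac V mq)) := by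
    refine ((coeffRegular_rotObs A).mul ((coeffRegular_rotObs_negReflect A).reflection _)).mul ?_
    exact (coeffRegular_quadratic fun p q => continuous_rotDirac_apply mq p q).grassmannExp fun U => coord_empty_quadratic _
  simp only [fermiIntegral_osPair_eq]
  exact (h.measurable_apply fermiIntegral).const_mul _

end Regularity

/-! ## Gauge dependence of the slice coupling -/

/-- The slice coupling depends on the slice links only. [folklore] -/
theorem sliceK_congr (mq : Fin Nf → ℝ) {W W' : GaugeConfig 4 L 𝔾} (h : ∀ e ∈ (sliceZeroEdges : Finset (Edge 4 L)), W e = W' e) :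
    sliceK W mq = sliceK W' mq := by
  have hB : ∀ m, sliceB W m = sliceB W' m := fun m => by
    ext p q
    rw [sliceB_apply, sliceB_apply]
    congr 2
    refine Finset.sum_congr rfl fun j _ => ?_
    have hT : ∀ p q : ColourSite L, hopT W j p q = hopT W' j p q := fun p q => by
      rw [hopT_apply, hopT_apply]
      split_ifs
      · rw [h _ (by simp [sliceZeroEdges, Fin.succ_ne_zero])]
      · rfl
    rw [hT, hT]
  ext j k
  rw [sliceK_apply, sliceK_apply, hB]

/-! ## Gauge dependence of the coefficient functions -/

section Dependence

/-- The layer variables depend on the layer links only. [folklore] -/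
theorem xiVar_congr {S : ℕ} {w : FermiIdx Nf L ⊕ₗ FermiIdx Nf L} (hw : w ∈ layerGens S) {W W' : GaugeConfig 4 L 𝔾}
    (h : ∀ e ∈ layerEdges S, W e = W' e) : xiVar w W = xiVar w W' := by
  rw [mem_layerGens] at hw
  rcases hh : ofLex w with i | i
  · have hw' : w = toLex (Sum.inl (quarkEquiv (quarkEquiv.symm i))) := by rw [Equiv.apply_symm_apply, ← hh, toLex_ofLex]
    rw [hw'] at hw ⊢
    have ht : ((quarkEquiv.symm i).2.1 0).val = S := by simpa [genTimeT, idxTime] using hw.1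
    have he : W ((quarkEquiv.symm i).2.1, 0) = W' ((quarkEquiv.symm i).2.1, 0) := h _ (by simp [layerEdges, ht])
    rw [xiVar_inl, xiVar_inl, he]
  · have hw' : w = toLex (Sum.inr (quarkEquiv (quarkEquiv.symm i))) := by rw [Equiv.apply_symm_apply, ← hh, toLex_ofLex]
    rw [hw'] at hw ⊢
    have ht : ((quarkEquiv.symm i).2.1 0).val = S := by simpa [genTimeT, idxTime] using hw.1
    have he : W ((quarkEquiv.symm i).2.1, 0) = W' ((quarkEquiv.symm i).2.1, 0) := h _ (by simp [layerEdges, ht])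
    rw [xiVar_inr, xiVar_inr, he]


variable {R : ℕ} (A : QCDLatticeObservable Nf R) (mq : Fin Nf → ℝ) {S : ℕ} (hL : L = 2 * S + 1) (hS : 1 ≤ S)
  (hA : A.IsPositiveTime) (hE : A.LinksEndBy S)
include hL hS hA hE

/-- **`𝒢_t` depends on `negSide ∪ layer ∪ slice` only.** [folklore] -/
theorem gObsT_congr {t : Finset (FermiIdx Nf L ⊕ₗ FermiIdx Nf L)} (ht : t ⊆ layerGens S) {W W' : GaugeConfig 4 L 𝔾}
    (h : ∀ e ∈ (negSideEdges S ∪ layerEdges S ∪ sliceZeroEdges : Finset (Edge 4 L)), W e = W' e) :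
    gObsT A mq t W = gObsT A mq t W' := by
  have hN : ∀ e ∈ negSideEdges S, W e = W' e := fun e he => h e (by simp [he])
  have hLy : ∀ e ∈ layerEdges S, W e = W' e := fun e he => h e (by simp [he])
  have hZ : ∀ e ∈ (sliceZeroEdges : Finset (Edge 4 L)), W e = W' e := fun e he => h e (by simp [he])
  unfold gObsT gObs
  rw [rotObs_congr A hL hA hE (fun e he => negReflect_apply_eq_of_mem_posLinks hL hS hN he),
    posPart_congr hL hS mq (fun e he => negReflect_apply_eq_of_mem_posLinks hL hS hN he), uuPart_congr hL hS mq hZ]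
  congr 1
  unfold ordProd
  congr 1
  exact List.map_congr_left fun w hw => xiVar_congr (ht ((Finset.mem_sort _).1 hw)) hLy

/-- **The coefficient functions depend on `negSide ∪ layer ∪ slice` only.** [folklore] -/
theorem dependsOn_gCoef {t : Finset (FermiIdx Nf L ⊕ₗ FermiIdx Nf L)} (ht : t ⊆ layerGens S) (J : Finset (SliceIdx Nf L)) :
    DependsOn (gCoef A mq t J : GaugeConfig 4 L 𝔾 → ℂ)
      (↑(negSideEdges S ∪ layerEdges S ∪ sliceZeroEdges : Finset (Edge 4 L)) : Set (Edge 4 L)) := by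
  intro W W' h
  unfold gCoef
  rw [gObsT_congr A mq hL hS hA hE ht (fun e he => h e (Finset.mem_coe.2 he))]

end Dependence

/-! ## The kernel and its positivity -/

section Kernel

variable (mq : Fin Nf → ℝ) {S : ℕ}

/-- The number of slice variables is even (`= 12 N_f L³`). [folklore] -/
theorem even_card_sliceIdx : Even (Fintype.card (SliceIdx Nf L)) := by
  have : Fintype.card (SliceIdx Nf L) = Fintype.card (Fin Nf × TorusSite 3 L × Fin 3 × Fin 4) := rfl
  rw [this, Fintype.card_prod, Fintype.card_prod, Fintype.card_prod, Fintype.card_fin, Fintype.card_fin,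
    Fintype.card_fin]
  exact ⟨Nf * (Fintype.card (TorusSite 3 L) * (3 * 2)), by ring⟩

/-- `det(−K) = det K`. [folklore] -/
theorem det_neg_sliceK (U : GaugeConfig 4 L 𝔾) : (-sliceK U mq).det = (sliceK U mq).det := by
  rw [Matrix.det_neg, (even_card_sliceIdx (Nf := Nf) (L := L)).neg_one_pow, one_mul]

/-- `det K(U)` is a non-negative real (indeed positive) for `m_f > −1`. [folklore] -/
theorem det_sliceK_nonneg (hm : ∀ f, -1 < mq f) (U : GaugeConfig 4 L 𝔾) : 0 ≤ (sliceK U mq).det :=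
  (posDef_sliceK U mq hm).det_pos.le

/-- **The index set of the mechanism**: cone terms `t ⊆ layerGens S` and slice monomials `J`. [folklore] -/
abbrev MechIdx (Nf' L' : ℕ) [NeZero L'] (S' : ℕ) : Type :=
  ↥((layerGens (Nf := Nf') (L := L') S').powerset) × Finset (SliceIdx Nf' L')

/-- **The kernel** `P_{(t,J),(t',I)}(U) = [t = t'] ‖c₀‖² 2^{|t|} conj(det(−K(U))) conj Γ(K(U)⁻¹)_{IJ}`. [folklore] -/
def mechKernel (c₀ : ℂ) (a b : MechIdx Nf L S) (U : GaugeConfig 4 L 𝔾) : ℂ :=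
  if a.1 = b.1 then c₀ * conj c₀ * (2 : ℂ) ^ a.1.1.card * conj ((-sliceK U mq).det) *
    conj (Gamma (sliceK U mq)⁻¹ b.2 a.2) else 0

/-- **The kernel is positive semidefinite pointwise.** [folklore] -/
theorem mechKernel_psd (hm : ∀ f, -1 < mq f) (c₀ : ℂ) (V : GaugeConfig 4 L 𝔾) (x : MechIdx Nf L S → ℂ) :
    0 ≤ ∑ a, ∑ b, x a * conj (x b) * mechKernel mq c₀ a b V := by
  have hdet : conj ((-sliceK V mq).det) = (sliceK V mq).det := by
    rw [det_neg_sliceK]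
    obtain ⟨-, h2⟩ := Complex.nonneg_iff.1 (det_sliceK_nonneg mq hm V)
    exact Complex.conj_eq_iff_im.2 h2.symm
  -- collapse the block-diagonal kernel
  have hcollapse : (∑ a : MechIdx Nf L S, ∑ b : MechIdx Nf L S, x a * conj (x b) * mechKernel mq c₀ a b V) =
      ∑ t : ↥((layerGens (Nf := Nf) (L := L) S).powerset),
        c₀ * conj c₀ * (2 : ℂ) ^ t.1.card * (sliceK V mq).det *
          ∑ I : Finset (SliceIdx Nf L), ∑ J : Finset (SliceIdx Nf L),
            x (t, I) * conj (x (t, J)) * conj (Gamma (sliceK V mq)⁻¹ J I) := by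
    rw [Fintype.sum_prod_type]
    refine Finset.sum_congr rfl fun t _ => ?_
    rw [Finset.mul_sum]
    refine Finset.sum_congr rfl fun I _ => ?_
    rw [Fintype.sum_prod_type, Finset.mul_sum, Finset.sum_comm]
    refine Finset.sum_congr rfl fun J _ => ?_
    simp only [mechKernel, mul_ite, mul_zero]
    rw [Finset.sum_ite_eq, if_pos (Finset.mem_univ _), hdet]
    ring
  rw [hcollapse]
  refine Finset.sum_nonneg fun t _ => ?_
  -- the slice factor is the conjugate of the non-negative real `Σ x conj x Γ(K⁻¹)`
  have h := sum_mul_conj_mul_Gamma_nonneg (posSemidef_inv_sliceK V mq hm) (fun I => x (t, I))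
  have hconj : (∑ I : Finset (SliceIdx Nf L), ∑ J : Finset (SliceIdx Nf L),
      x (t, I) * conj (x (t, J)) * conj (Gamma (sliceK V mq)⁻¹ J I)) =
      conj (∑ I : Finset (SliceIdx Nf L), ∑ J : Finset (SliceIdx Nf L),
        x (t, I) * conj (x (t, J)) * Gamma (sliceK V mq)⁻¹ I J) := by
    rw [map_sum, Finset.sum_comm]
    refine Finset.sum_congr rfl fun J _ => ?_
    rw [map_sum]
    refine Finset.sum_congr rfl fun I _ => ?_
    simp only [map_mul, Complex.conj_conj]
    ring
  have hG : 0 ≤ ∑ I : Finset (SliceIdx Nf L), ∑ J : Finset (SliceIdx Nf L),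
      x (t, I) * conj (x (t, J)) * conj (Gamma (sliceK V mq)⁻¹ J I) := by
    obtain ⟨-, h2⟩ := Complex.nonneg_iff.1 h
    rw [hconj, Complex.conj_eq_iff_im.2 h2.symm]
    exact h
  refine mul_nonneg (mul_nonneg (mul_nonneg (mul_star_self_nonneg c₀) (pow_nonneg zero_le_two _))
    (det_sliceK_nonneg mq hm V)) hG

/-- The kernel is measurable. [folklore] -/
theorem measurable_mechKernel (hm : ∀ f, -1 < mq f) (c₀ : ℂ) (a b : MechIdx Nf L S) :
    Measurable (mechKernel mq c₀ a b : GaugeConfig 4 L 𝔾 → ℂ) := by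
  unfold mechKernel
  split_ifs
  · refine ((measurable_const.mul (Complex.continuous_conj.measurable.comp ?_)).mul
      (Complex.continuous_conj.measurable.comp (continuous_Gamma_inv_sliceK mq hm _ _).measurable))
    exact (Continuous.matrix_det ((continuous_sliceK mq).neg)).measurable
  · exact measurable_const

/-- The kernel is bounded. [folklore] -/
theorem exists_bound_mechKernel (hm : ∀ f, -1 < mq f) (c₀ : ℂ) (a b : MechIdx Nf L S) :
    ∃ C : ℝ, ∀ U : GaugeConfig 4 L 𝔾, ‖mechKernel mq c₀ a b U‖ ≤ C := by
  unfold mechKernel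
  split_ifs
  · refine exists_norm_le_of_continuous ?_
    exact ((continuous_const.mul (Complex.continuous_conj.comp (Continuous.matrix_det ((continuous_sliceK mq).neg)))).mul
      (Complex.continuous_conj.comp (continuous_Gamma_inv_sliceK mq hm _ _)))
  · exact ⟨0, fun _ => by simp⟩

/-- The kernel depends on the slice links only. [folklore] -/
theorem dependsOn_mechKernel (c₀ : ℂ) (a b : MechIdx Nf L S) :
    DependsOn (mechKernel mq c₀ a b : GaugeConfig 4 L 𝔾 → ℂ) (↑(sliceZeroEdges : Finset (Edge 4 L)) : Set (Edge 4 L)) := by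
  intro W W' h
  unfold mechKernel
  rw [sliceK_congr mq (fun e he => h e (Finset.mem_coe.2 he))]

end Kernel

/-! ## The positivity of the numerator and of the denominator -/

section Positivity

variable {R : ℕ} (A : QCDLatticeObservable Nf R) (mq : Fin Nf → ℝ) {S : ℕ} (hL : L = 2 * S + 1) (hS : 1 ≤ S)
  (hRL : 2 * R < L) (hA : A.IsPositiveTime) (hE : A.LinksEndBy S) (hm : ∀ f, -1 < mq f) {β : ℝ} (hβ : 0 ≤ β)

/-- **The constant `c₀ = det R · c_N · C · ε`** of the covariance identity. [folklore] -/
def posConst (cN : ℂ) : ℂ :=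
  LinearMap.det (blockSubst ℂ (spinBlock (Nf := Nf) (L := L) ((2 : ℂ)⁻¹ • spinWᴴ)) (spinBlock ((2 : ℂ)⁻¹ • spinWᵀ))) *
    cN * topConst Nf L * (-1 : ℂ) ^ (Fintype.card (SliceIdx Nf L) * (Fintype.card (SliceIdx Nf L) - 1) / 2)

/-- `det R ≠ 0` (the frame change is invertible: `R ∘ R' = id`). [folklore] -/
theorem det_blockSubst_ne_zero :
    LinearMap.det (blockSubst ℂ (spinBlock (Nf := Nf) (L := L) ((2 : ℂ)⁻¹ • spinWᴴ)) (spinBlock ((2 : ℂ)⁻¹ • spinWᵀ))) ≠ 0 := by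
  intro h0
  have h := congrArg LinearMap.det (blockSubst_comp_blockSubst (spinBlock (Nf := Nf) (L := L) ((2 : ℂ)⁻¹ • spinWᴴ))
    (spinBlock ((2 : ℂ)⁻¹ • spinWᵀ)) (spinBlock spinW) (spinBlock (spinW.map star)))
  rw [LinearMap.det_comp, h0, zero_mul, spinBlock_half_conjTranspose_mul, spinBlock_half_transpose_mul,
    blockSubst_one_one, LinearMap.det_id] at h
  exact zero_ne_one h

/-- `c₀ ≠ 0`. [folklore] -/
theorem posConst_ne_zero {cN : ℂ} (hcN : cN ≠ 0) : posConst (Nf := Nf) (L := L) cN ≠ 0 :=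
  mul_ne_zero (mul_ne_zero (mul_ne_zero det_blockSubst_ne_zero hcN) topConst_ne_zero) (pow_ne_zero _ (by norm_num))

include hL hS hRL hA hE hm hβ in
/-- **Positivity of the OS pairing integral, up to the constant**: `0 ≤ c₀ · conj ∫ F_A dμ_W` where
`F_A(V) = ∫dψ̄dψ A(V)(ΘA)(V)e^{−ψ̄D^{AP}(V)ψ}` (from the covariance identity, the regularity of its
coefficients and `wilsonExpectation_nonneg_of_negCovariantKernel`). [cite: MontvayMunster1994, §4.2.3 (4.96) and (4.107)–(4.110)] [cite: OsterwalderSeiler1978, §3] -/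
theorem posConst_mul_conj_integral_nonneg {cN : ℂ}
    (hcN : fermiThetaRot (grassmannBasis ℂ _ (posGens Nf L)) = cN • grassmannBasis ℂ _ (negGens Nf L)) :
    0 ≤ posConst (Nf := Nf) (L := L) cN * conj (∫ V, fermiIntegral (A.onTorus L 0 V * A.osAdjoint.onTorus L 0 V * fermiBoltzmannAP V mq)
      ∂(wilsonMeasure (d := 4) (L := L) (fundamentalRep (Fin 3)) β)) := by
  set c₀ := posConst (Nf := Nf) (L := L) cN with hc₀
  set F : GaugeConfig 4 L 𝔾 → ℂ := fun V =>
    fermiIntegral (A.onTorus L 0 V * A.osAdjoint.onTorus L 0 V * fermiBoltzmannAP V mq) with hF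
  have hFm : Measurable F := measurable_fermiIntegral_osPair A mq
  -- uniform bounds
  choose Cg hCg using fun a : MechIdx Nf L S => exists_bound_gCoef A mq a.1.1 a.2
  choose Cp hCp using fun ab : MechIdx Nf L S × MechIdx Nf L S => exists_bound_mechKernel mq hm c₀ ab.1 ab.2
  set Kg : ℝ := ∑ a, |Cg a| + ∑ ab, |Cp ab| with hKg
  have hKg1 : ∀ a, Cg a ≤ Kg := fun a =>
    ((le_abs_self _).trans (Finset.single_le_sum (f := fun a => |Cg a|) (fun _ _ => abs_nonneg _)
      (Finset.mem_univ a))).trans (le_add_of_nonneg_right (Finset.sum_nonneg fun _ _ => abs_nonneg _))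
  have hKg2 : ∀ ab, Cp ab ≤ Kg := fun ab =>
    ((le_abs_self _).trans (Finset.single_le_sum (f := fun ab => |Cp ab|) (fun _ _ => abs_nonneg _)
      (Finset.mem_univ ab))).trans (le_add_of_nonneg_left (Finset.sum_nonneg fun _ _ => abs_nonneg _))
  -- `conj c₀` in pieces
  have hcc : conj c₀ = conj (LinearMap.det (blockSubst ℂ (spinBlock (Nf := Nf) (L := L) ((2 : ℂ)⁻¹ • spinWᴴ))
      (spinBlock ((2 : ℂ)⁻¹ • spinWᵀ)))) * conj cN * conj (topConst Nf L) *
      (-1 : ℂ) ^ (Fintype.card (SliceIdx Nf L) * (Fintype.card (SliceIdx Nf L) - 1) / 2) := by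
    simp only [hc₀, posConst, map_mul, map_pow, map_neg, map_one]
  -- the covariance identity
  have hcov : ∀ U Y : GaugeConfig 4 L 𝔾, c₀ * conj (F (translateLayer S Y U)) =
      ∑ a : MechIdx Nf L S, ∑ b : MechIdx Nf L S,
        gCoef A mq a.1.1 a.2 (LatticeRP.splice (layerEdges S) (U, Y)) *
          conj (gCoef A mq b.1.1 b.2 U.negReflect) * mechKernel mq c₀ a b U := by
    intro U Y
    simp only [hF]
    rw [fermiIntegral_osPair_eq, berezin_osIntegrand_translateLayer A mq hL hS hRL hA hE hm U Y hcN]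
    set z := LatticeRP.splice (layerEdges S) (U, Y) with hz
    -- right-hand side: collapse the block-diagonal kernel to a sum over `t ⊆ layer`
    have hRHS : (∑ a : MechIdx Nf L S, ∑ b : MechIdx Nf L S,
          gCoef A mq a.1.1 a.2 z * conj (gCoef A mq b.1.1 b.2 U.negReflect) * mechKernel mq c₀ a b U) =
        ∑ t ∈ (layerGens S).powerset, ∑ J : Finset (SliceIdx Nf L), ∑ I : Finset (SliceIdx Nf L),
          gCoef A mq t J z * conj (gCoef A mq t I U.negReflect) *
            (c₀ * conj c₀ * (2 : ℂ) ^ t.card * conj ((-sliceK U mq).det) * conj (Gamma (sliceK U mq)⁻¹ I J)) := by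
      rw [Fintype.sum_prod_type, ← Finset.sum_coe_sort (layerGens S).powerset]
      refine Finset.sum_congr rfl fun t _ => Finset.sum_congr rfl fun J _ => ?_
      rw [Fintype.sum_prod_type, Finset.sum_comm]
      refine Finset.sum_congr rfl fun I _ => ?_
      simp only [mechKernel, mul_ite, mul_zero]
      rw [Finset.sum_ite_eq, if_pos (Finset.mem_univ _)]
    rw [hRHS]
    -- left-hand side: distribute `conj` and the constants
    simp only [map_mul, map_sum, map_pow, map_neg, map_one, map_ofNat, Complex.conj_conj, Finset.mul_sum]
    refine Finset.sum_congr rfl fun t _ => ?_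
    rw [Finset.sum_comm]
    refine Finset.sum_congr rfl fun J _ => Finset.sum_congr rfl fun I _ => ?_
    rw [hcc]
    ring
  have key := wilsonExpectation_nonneg_of_negCovariantKernel (d := 4) (G := 𝔾) (fundamentalRep (Fin 3)) hL hS
    (continuous_fundamentalRep (Fin 3)) hβ (𝓘 := MechIdx Nf L S)
    (g := fun a W => gCoef A mq a.1.1 a.2 W) (Pk := mechKernel mq c₀)
    (fun a => measurable_gCoef A mq _ _) (fun a b => measurable_mechKernel mq hm c₀ a b) (Kg := Kg)
    (fun a U => (hCg a U).trans (hKg1 a)) (fun a b U => (hCp (a, b) U).trans (hKg2 (a, b)))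
    (fun a => dependsOn_gCoef A mq hL hS hA hE (Finset.mem_powerset.1 a.1.2) a.2)
    (fun a b => dependsOn_mechKernel mq c₀ a b) (fun V x => mechKernel_psd mq hm c₀ V x)
    (Φ := fun V => c₀ * conj (F V)) ((Complex.continuous_conj.measurable.comp hFm).const_mul _) hcov
  change 0 ≤ ∫ V, c₀ * conj (F V) ∂(wilsonMeasure (d := 4) (L := L) (fundamentalRep (Fin 3)) β) at key
  rwa [integral_const_mul, integral_conj] at key

end Positivity

/-! ## The unit observable and the final quotient -/

section Final

/-- The unit observable placed on the torus, paired with its OS adjoint, is `1`. [folklore] -/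
theorem one_osPair (Nf : ℕ) (U : GaugeConfig 4 L 𝔾) :
    (QCDLatticeObservable.one Nf 0).onTorus L 0 U * (QCDLatticeObservable.one Nf 0).osAdjoint.onTorus L 0 U = 1 := by
  have h1 : ∀ W : GaugeConfig 4 L 𝔾, (QCDLatticeObservable.one Nf 0).onTorus L 0 W = 1 := fun W => by
    unfold QCDLatticeObservable.onTorus QCDLatticeObservable.one
    exact map_one _
  rw [osAdjoint_onTorus_zero, h1, h1, torusTheta_one, mul_one]

/-- The unit observable is positive-time. [folklore] -/
theorem one_isPositiveTime (Nf : ℕ) : (QCDLatticeObservable.one Nf 0).IsPositiveTime :=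
  ⟨fun _ h => (Finset.notMem_empty _ h).elim, fun _ => Subalgebra.one_mem _⟩

/-- The unit observable ends by any time. [folklore] -/
theorem one_linksEndBy (Nf : ℕ) (T : ℤ) : (QCDLatticeObservable.one Nf 0).LinksEndBy T :=
  fun _ h => (Finset.notMem_empty _ h).elim

omit [NeZero L] in
/-- The quotient of two complex numbers `N, D` with `c·conj N ≥ 0`, `c·conj D ≥ 0`, `c ≠ 0` has
non-negative real part. [folklore] -/
theorem re_div_nonneg_of_mul_conj_nonneg {c N D : ℂ} (hc : c ≠ 0) (hN : 0 ≤ c * conj N) (hD : 0 ≤ c * conj D) :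
    0 ≤ (N / D).re := by
  have hc' : conj c ≠ 0 := (map_ne_zero _).2 hc
  obtain ⟨haN, hiN⟩ := Complex.nonneg_iff.1 hN
  obtain ⟨haD, hiD⟩ := Complex.nonneg_iff.1 hD
  have hNa : N = (c * conj N) / conj c := by
    rw [eq_div_iff hc', mul_comm, ← Complex.conj_conj (c * conj N), Complex.conj_eq_iff_im.2 hiN.symm, map_mul,
      Complex.conj_conj]
  have hDa : D = (c * conj D) / conj c := by
    rw [eq_div_iff hc', mul_comm, ← Complex.conj_conj (c * conj D), Complex.conj_eq_iff_im.2 hiD.symm, map_mul,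
      Complex.conj_conj]
  rw [hNa, hDa, div_div_div_cancel_right₀ hc', ← Complex.re_add_im (c * conj N), ← Complex.re_add_im (c * conj D),
    ← hiN, ← hiD]
  simp only [Complex.ofReal_zero, zero_mul, add_zero, ← Complex.ofReal_div, Complex.ofReal_re]
  exact div_nonneg haN haD

/-- **Site-reflection positivity of lattice QCD with Wilson quarks** (`r = 1`, `m_f > −1`, `β ≥ 0`,
odd torus `L = 2S+1`, antiperiodic quarks): `⟨A · ΘA⟩_AP ≥ 0` for every positive-time gauge-invariant
local observable `A` ending by `S` — discharge of `WilsonQCDSiteReflectionPositivityAP`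
(Montvay–Münster 1994 §4.2.3 (4.90)–(4.110); Lüscher 1977; Osterwalder–Seiler 1978 §3).
[cite: Luscher1977, §3] [cite: MontvayMunster1994, §4.2.3 (4.90)–(4.110)] [cite: OsterwalderSeiler1978, §2–§3] -/
theorem WilsonQCDSiteReflectionPositivityAP_holds : WilsonQCDSiteReflectionPositivityAP := by
  intro Nf β S mq hβ hm hS R A hA hE hRL
  refine ⟨?_, WilsonQCDSiteReflectionPositivityAP_im Nf β S mq R A⟩
  obtain ⟨cN, hcNne, hcN⟩ := exists_fermiThetaRot_basis_posGens_ne (Nf := Nf) (L := 2 * S + 1) ⟨S, rfl⟩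
  have hN := posConst_mul_conj_integral_nonneg (L := 2 * S + 1) A mq rfl hS hRL hA hE hm hβ hcN
  have hD := posConst_mul_conj_integral_nonneg (L := 2 * S + 1) (QCDLatticeObservable.one Nf 0) mq rfl hS (by omega)
    (one_isPositiveTime Nf) (one_linksEndBy Nf S) hm hβ hcN
  simp only [one_osPair, one_mul] at hD
  unfold qcdTorusExpectAP
  exact re_div_nonneg_of_mul_conj_nonneg (posConst_ne_zero hcNne) hN hD

end Final

end

end Literature.MathematicalPhysics.QuantumFieldTheory

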